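import Literature.MathematicalPhysics.PowerSystems.DroopMicrogridHamiltonian
import Literature.MathematicalPhysics.PowerSystems.PhaseCohesiveEquilibriumUniqueness
import Literature.Analysis.ODE.LyapunovIndirectMethod
import Literature.Analysis.ODE.ExtendedInvariancePrinciple
import Literature.MathematicalPhysics.PowerSystems.LosslessMultimachineTypeCount

/-!
# Droop-controlled microgrid with `Q–V` dynamics: local exponential stability, modulo the
# rotation, of an equilibrium with positive semidefinite Hessian of the Hamiltonian
# (Schiffer–Ortega–Astolfi–Raisch–Sezi 2014 Prop. 5.9; Shin–Zavala 2020 Prop. 1 / Remark 2)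

Topic `Literature/MathematicalPhysics/PowerSystems`, namespace
`Literature.MathematicalPhysics.PowerSystems.DroopPH` (the companion file
`DroopMicrogridHamiltonian.lean`'s model record: `n` droop-controlled grid-forming inverters with
first-order `P–ω` AND `Q–V` droop/filter dynamics on a Kron-reduced LOSSLESS network, state
`x = (θ, ω̃, V) ∈ ℝⁿ × ℝⁿ × ℝⁿ`, field (9) `field`, Hamiltonian (10) with Hessian (15) `hessCLM`).
0 named facts, 0 sorry: every declaration is proved from Mathlib + the tree.  LADDER-GRIDFUSION rung
G3.b («droop microgrid with Q–V voltage dynamics»): the companion file typed the model, its Hamiltonian,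
the dissipation identity and the factorisation `∂f/∂x(x*) = (J − R(x*))∇ₓₓH(x*)` of the linearisation
at rest points, and said explicitly that the STABILITY statement (Schiffer et al. Prop. 5.9 /
Shin–Zavala Prop. 1) was not formalised.  This file proves it, with a rate.

## Sources (held; read this session on the page; `pNNNN Lnn` = page / line of the held text)

* [SchifferEtAl2014] J. Schiffer, R. Ortega, A. Astolfi, J. Raisch, T. Sezi, *Conditions for
  stability of droop-controlled inverter-based microgrids*, Automatica 50 (2014) 2457–2469
  (doi 10.1016/j.automatica.2014.08.009): §5 intro p0011 L3 («asymptotically stable, i.e., such that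
  all trajectories … converge to the synchronized motion (17) (up to a uniform shift of all angles)
  … the dependence with respect to δ of the dynamics (9), (1) is via angle differences … the flow … is
  invariant to a shift in the δ coordinate»); §5.3 PROPOSITION 5.9 p0012 L23–L25 («Consider the system
  (9), (1) with Assumptions 5.1 and 5.4 … Then the equilibrium x^s = col(θ^s, 0_n, V^s) of the system
  (21)–(22) is locally asymptotically stable.») and its proof L27–L55 (port-Hamiltonian form (32),
  `∇H(x^s) = 0`, Hessian (35) «with L, W, D and T(θ^s) … and A := diag(τ_Pi/k_Pi)», positive
  definiteness ⇔ (36) ⇔ (31) by Lemma 5.8, then «R(x) ≥ 0 … it suffices to show that – along the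
  trajectories of the system (32) – the implication (37) holds … the first condition implies ω = 0_n.
  Hence, θ is constant. The second condition implies V constant. Therefore, the invariant set where
  Ḣ(x(t)) ≡ 0 is an equilibrium … x^s is an isolated minimum of H(x)»).  The display equations
  (21)–(38) are not legible in the held copy; the model and the Hessian blocks are read from the
  secondary source, as in the companion file:
* [ShinZavala2020] S. Shin, V. M. Zavala, arXiv:2002.09802: Remark 2 p0004 L53–L60 («The dynamic
  stability condition of (7) states that the Jacobian ∂f/∂x(x*,u*) of f(·,u*) evaluated at x* is
  Hurwitz … all the eigenvalues λ of the Jacobian matrix satisfy ℜ(λ) < 0»); §III-C Proposition 1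
  p0005 L130–L137 («… any local strict minimum x* of H(·,u) in D with ∇ₓₓH(x*,u) > 0 is locally
  asymptotically stable»; «The droop-controlled microgrid (9) satisfies assumptions of Proposition 1
  with D = ℝ^{2n−1} × ℝⁿ_{>0}»); eqs. (9), (12)–(13), (15) as quoted in the companion file.
* [Khalil2002] H. K. Khalil, *Nonlinear Systems*, 3rd ed., Thm. 4.7 (Lyapunov's indirect method) —
  in the tree as `Literature/Analysis/ODE/LyapunovIndirectMethod.lean`; used here through its
  symmetry-reduced form `exists_expStable_modSymmetry_of_eig_re_neg_or_smul` (exponential convergence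
  to the orbit `x* + ℝr` of a field invariant under `x ↦ x + cr`, from: every eigenpair of the
  projected Jacobian has `Re μ < 0` or is `(0, r)`).

## What is proved, and how (the print's architecture, with the LaSalle step replaced by its linear
counterpart)

The print: `H` has a strict local minimum at `x^s` in the reduced coordinates (positive definite
reduced Hessian (36) ⇔ (31)), `Ḣ = −∇HᵀR∇H ≤ 0`, and on `Ḣ ≡ 0` the frequency and voltage gradients
vanish, forcing an equilibrium; LaSalle ⇒ asymptotic stability.  Here, in the FULL angle coordinates
(all `n` angles kept, as in the companion file; the print's reduced system is the quotient by the
rotation `θ ↦ θ + c𝟙`):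
1. §1–§2: flat coordinates `ℝⁿ × ℝⁿ × ℝⁿ ≃ ℝ^{Fin n ⊕ (Fin n ⊕ Fin n)}` (sup-norm preserving), the
   rotational invariance `f(θ + c𝟙, ω̃, V) = f(θ, ω̃, V)` (`field_add_constMode`), the Jacobian MATRIX
   `jacMat x` of the flat field (= the companion's Fréchet derivative `jacCLM x` in coordinates,
   `hasFDerivAt_flatField`).
2. §3: kernel facts of the Hessian (15): `L(x)𝟙 = 0`, `𝟙ᵀW(x) = 0` (lossless: `Σ_i P_i ≡ 0`), hence
   `∇ₓₓH(x)(𝟙, 0, 0) = 0` (`hessCLM_constMode`) and `Σ_i ∂P_i = 0`; symmetry of `∇ₓₓH(x)`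
   (`pair_hessCLM_comm`); the LEFT null vector `(1/k_P, τ_P/k_P, 0)` of `∂f/∂x(x)` at every state
   (`pair_leftMode_jacCLM`) — it makes the tree theorem's projected Jacobian equal to `∂f/∂x(x*)`.
3. §4 **`eig_re_neg_or_rotation`** / **`jacMat_eig_re_neg_or_rotation`**: at an equilibrium `x*`
   with `V* > 0`, `k, τ > 0`, `B` symmetric and `∇ₓₓH(x*) ⪰ 0` with kernel `ℝ(𝟙,0,0)`, every complex
   eigenpair `(μ, v)` of `∂f/∂x(x*)` has `Re μ < 0`, or `μ = 0` and `v ∈ ℂ(𝟙,0,0)`.  Proof: with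
   `Q = ∇ₓₓH(x*)` and `∂f/∂x(x*) = (J − R)Q` (companion `jacCLM_eq_JR_hess_of_equilibrium`), the
   dissipation identity `wᵀ(J − R)w = −wᵀRw` (companion `pairing_JRmul`) applied to `w = Qa, Qb`
   (`v = a + ib`) gives `Re μ · (aᵀQa + bᵀQb) = −(Qa)ᵀR(Qa) − (Qb)ᵀR(Qb) ≤ 0`; if `Re μ = 0` the
   `ω̃`- and `V`-rows of `Qa, Qb` vanish (the print's «ω = 0_n … V constant»), and the structure of
   `J − R` then forces `Qa = Qb = 0`, i.e. `a, b` rotations and `μ = 0`.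
4. §5 **`expStable_modRotation_of_hessian`**: ∃ `ρ, k, λ > 0`, every solution of (9) on `[0, T]`
   with `‖x(0) − x*‖ < ρ` satisfies `‖x(t) − (θ* + c𝟙, ω̃*, V*)‖ ≤ k‖x(0) − x*‖e^{−λt}` for some
   rotation `c` — local exponential stability of `x*` modulo the rotation, i.e. of the print's `x^s`
   in the reduced coordinates (stronger than «asymptotically stable»: the rate comes from the
   spectral road).  **`expStable_modRotation_of_reducedHessian_posDef`**: the same from the print's
   hypothesis shape — `vᵀ∇ₓₓH(x*)v > 0` for all `v ≠ 0` with `v_θ,i₀ = 0` (reduced Hessian positive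
   definite, reference node `i₀`; the print's (31)/(36) with Lemma 5.8).
5. §6 (append) the hypothesis in the print's MATRIX shape: the `(θ, V)`-block `hessThetaV x =
   [L W; Wᵀ D+T]` of (35)/(36) (`pair_hessCLM_eq_blocks`: the `ω̃`-block `A ≻ 0` splits off),
   **`expStable_modRotation_of_thetaVBlock_posDef`** (block (36) positive definite in a reference
   gauge ⇒ the conclusion), and the full-angle form of Lemma 5.8, `hessL_quadForm_eq_zero_iff`
   (connected coupling graph, strict phase cohesiveness, `V > 0` ⇒ `v_θᵀL(x)v_θ = 0 ⇔ v_θ` constant).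
6. §7 (append) Shin–Zavala's Schur-complement form (16): `schurS x = L − W(D+T)⁻¹Wᵀ`, the
   completed square `hessThetaV_quadForm_eq_schur`, and
   **`expStable_modRotation_of_schur_posDef`** (`D + T ≻ 0` and `S(x*)` positive definite in a
   reference gauge ⇒ the conclusion).
7. §8 (append) EXISTENCE: the field (9) is `C¹` (`contDiff_field`) and
   **`exists_solution_expStable_modRotation`** — from every `x₀` with `‖x₀ − x*‖ < ρ` there is a
   solution on `[0, ∞)` with `x(0) = x₀` converging exponentially to a rotation of `x*` (confinement
   by the estimate + the tree's `exists_global_solution_of_confined`, Teschl Cor. 2.15).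
8. §9 (append) SHARPNESS: `sum_P_eq_zero`, `H_add_constMode` (`H(θ + c𝟙,·) = H − cΣP^u`), hence
   rotation invariance of `H` at equilibria, `continuousAt_H`, `hasDerivAt_H_line`,
   `H_lt_of_negCurvature` (a direction with `vᵀ∇ₓₓH(x*)v < 0` gives `H(x* + εv) < H(x*)` for all
   small `ε > 0`) and **`not_tendsto_of_negCurvature`**: then arbitrarily close to `x*` there are
   initial states from which no positive-voltage solution converges to any rotation of `x*`
   (`Ḣ ≤ 0` along solutions, companion `H_antitoneOn`).
9. §10 (append) UNIQUENESS: `solution_unique` — two solutions of (9) on `[0, T]` with the same initial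
   state coincide (the `C¹` field is Lipschitz on a ball containing both trajectories; Grönwall).
10. §11 (append) THE ROTATION IS DETERMINED: `⟨ℓ, x⟩`, `ℓ = (1/k_P, τ_P/k_P, 0)`, is a first integral
   at parameters admitting an equilibrium (`pair_leftMode_field`, `pair_leftMode_eq_of_solution`),
   so a solution converging to `x* + (c𝟙,0,0)` has `cΣk_P⁻¹ = ⟨ℓ, x(0) − x*⟩`
   (`rotation_eq_of_tendsto`), and **`exists_solution_expStable_rotation_eq`** names the limit
   rotation in the existence theorem.
11. §12 (append) THE DECOUPLED MODEL (18) (voltages frozen): `decField`, `decSystem` — it IS the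
   swing equation with `M = τ_P/k_P`, `D = 1/k_P`, `C_ij = Ṽ_iṼ_jB_ij` (`decField_eq_field`), so the
   tree's lossless multimachine theorem gives **`decoupled_expStable_modRotation`**: a strictly
   phase-cohesive equilibrium of (18) on a connected network is locally exponentially stable modulo
   the rotation, with the limit rotation identified (Shin–Zavala §IV-B, BY NAME
   `ClassicalModel.LosslessSystem.expStable_modRotation_of_normalOperation`).
12. §13 (append) `D(u) + T(x) ≻ 0` FROM DATA (Shin–Zavala, proof of Prop. 2): `hessT_quadForm_eq`,
   `hessT_quadForm_nonneg` (zero row sums, `B_ij ≥ 0` ⇒ `T(x) ⪰ 0` at every state),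
   **`posDef_hessD_add_hessT`** (`Q^u_i > 0`, `V_i ≠ 0` ⇒ `D + T ≻ 0`), hence
   **`expStable_modRotation_of_schur_posDef_noShunt`** — the Schur-complement certificate needs
   only `S(x*) ≻ 0` in a reference gauge.  Also Lemma 5.8 in the printed reduced form:
   **`refMinor_hessL_posDef`** (the `(n−1) × (n−1)` angle block with a reference node deleted is
   positive definite under connectivity and phase cohesiveness).

THREE COLUMNS / NOT CLAIMED.  MODELLED: everything is about the model `DroopPH` (lossless Kron-reduced
network `G_ij = 0`, only inverter nodes, first-order power filters, constant inputs, `V* > 0`); the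
hypothesis is a property of the Hessian (15) at the given equilibrium (to be CERTIFIED instance by
instance, e.g. by one exact `LDLᵀ` of the reduced Hessian; Prop. 2 / Lemma 5.8-type sufficient
conditions — phase cohesiveness `|θ_ij| < π/2` plus (31) — are not typed here beyond the companion's
`hessL_quadForm_nonneg`, `hessA_quadForm_pos`).  No estimate of `ρ, k, λ`; existence of solutions is
not asserted (solutions are quantified over); nothing is said about lossy networks, loads, inner loops,
or any real microgrid.  Corollary 5.12 (all `c_1i = 0`, LaSalle without (31)) is not typed.
-/

noncomputable section

namespace Literature.MathematicalPhysics.PowerSystems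

open _root_.Real _root_.Finset _root_.Set
open scoped _root_.Matrix

namespace DroopPH

variable {n : ℕ} (M : DroopPH n)

/-! ## §1 Flat coordinates `(θ | ω̃ | V)` on the state space `ℝⁿ × ℝⁿ × ℝⁿ` -/

/-- Index type of the flat coordinates `(θ | ω̃ | V)`. [folklore] -/
abbrev Idx (n : ℕ) : Type := Fin n ⊕ (Fin n ⊕ Fin n)

omit M in
/-- Flat coordinates of a state `x = (θ, ω̃, V)`. [folklore] -/
def flat (x : State n) : Idx n → ℝ := Sum.elim x.1 (Sum.elim x.2.1 x.2.2)

omit M in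
/-- The state with given flat coordinates. [folklore] -/
def unflat (y : Idx n → ℝ) : State n :=
  (fun i => y (Sum.inl i), fun i => y (Sum.inr (Sum.inl i)), fun i => y (Sum.inr (Sum.inr i)))

omit M in
/-- [folklore] -/
@[simp] private theorem flat_inl (x : State n) (i : Fin n) : flat x (Sum.inl i) = x.1 i := rfl

omit M in
/-- [folklore] -/
@[simp] private theorem flat_inr_inl (x : State n) (i : Fin n) : flat x (Sum.inr (Sum.inl i)) = x.2.1 i := rfl

omit M in
/-- [folklore] -/
@[simp] private theorem flat_inr_inr (x : State n) (i : Fin n) : flat x (Sum.inr (Sum.inr i)) = x.2.2 i := rfl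

omit M in
/-- [folklore] -/
private theorem unflat_flat (x : State n) : unflat (flat x) = x := rfl

omit M in
/-- [folklore] -/
private theorem flat_unflat (y : Idx n → ℝ) : flat (unflat y) = y := by
  ext (i | i | i) <;> rfl

omit M in
/-- [folklore] -/
private theorem flat_injective : Function.Injective (flat : State n → Idx n → ℝ) := fun x x' h => by
  rw [← unflat_flat x, ← unflat_flat x', h]

omit M in
/-- [folklore] -/
@[simp] private theorem flat_add (x x' : State n) : flat (x + x') = flat x + flat x' := by
  ext (i | i | i) <;> rfl

omit M in
/-- [folklore] -/
@[simp] private theorem flat_sub (x x' : State n) : flat (x - x') = flat x - flat x' := by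
  ext (i | i | i) <;> rfl

omit M in
/-- [folklore] -/
@[simp] private theorem flat_smul (c : ℝ) (x : State n) : flat (c • x) = c • flat x := by
  ext (i | i | i) <;> rfl

omit M in
/-- [folklore] -/
@[simp] private theorem flat_zero : flat (0 : State n) = 0 := by
  ext (i | i | i) <;> rfl

omit M in
/-- The flat coordinates as a continuous linear map. [folklore] -/
def flatL (n : ℕ) : State n →L[ℝ] (Idx n → ℝ) :=
  LinearMap.toContinuousLinearMap
    { toFun := flat
      map_add' := flat_add
      map_smul' := flat_smul }

omit M in
/-- The inverse coordinate map as a continuous linear map. [folklore] -/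
def unflatL (n : ℕ) : (Idx n → ℝ) →L[ℝ] State n :=
  LinearMap.toContinuousLinearMap
    { toFun := unflat
      map_add' := fun _ _ => rfl
      map_smul' := fun _ _ => rfl }

omit M in
/-- [folklore] -/
@[simp] private theorem flatL_apply (x : State n) : flatL n x = flat x := rfl

omit M in
/-- [folklore] -/
@[simp] private theorem unflatL_apply (y : Idx n → ℝ) : unflatL n y = unflat y := rfl

omit M in
/-- The flat coordinates preserve the sup norm. [folklore] -/
private theorem norm_flat (x : State n) : ‖flat x‖ = ‖x‖ := by
  apply le_antisymm
  · refine (pi_norm_le_iff_of_nonneg (norm_nonneg x)).2 ?_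
    rintro (i | i | i)
    · exact (norm_le_pi_norm x.1 i).trans (norm_fst_le x)
    · exact (norm_le_pi_norm x.2.1 i).trans ((norm_fst_le x.2).trans (norm_snd_le x))
    · exact (norm_le_pi_norm x.2.2 i).trans ((norm_snd_le x.2).trans (norm_snd_le x))
  · rw [Prod.norm_def, Prod.norm_def]
    refine max_le ?_ (max_le ?_ ?_)
    · exact (pi_norm_le_iff_of_nonneg (norm_nonneg _)).2 fun i =>
        norm_le_pi_norm (flat x) (Sum.inl i)
    · exact (pi_norm_le_iff_of_nonneg (norm_nonneg _)).2 fun i =>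
        norm_le_pi_norm (flat x) (Sum.inr (Sum.inl i))
    · exact (pi_norm_le_iff_of_nonneg (norm_nonneg _)).2 fun i =>
        norm_le_pi_norm (flat x) (Sum.inr (Sum.inr i))

/-- The rotation mode `(𝟙, 0, 0)` in flat coordinates (uniform shift of all angles).
[cite: SchifferEtAl2014, §5 («up to a uniform shift of all angles»)] -/
def rotMode (n : ℕ) : Idx n → ℝ := Sum.elim (fun _ => 1) 0

omit M in
/-- [folklore] -/
private theorem flat_constMode (c : ℝ) : flat ((fun _ => c, 0, 0) : State n) = c • rotMode n := by
  ext (i | i | i) <;> simp [rotMode]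

omit M in
/-- [folklore] -/
private theorem unflat_add_smul_rotMode (y : Idx n → ℝ) (c : ℝ) :
    unflat (y + c • rotMode n) = unflat y + ((fun _ => c, 0, 0) : State n) := by
  refine Prod.ext (funext fun i => ?_) (Prod.ext (funext fun i => ?_) (funext fun i => ?_)) <;>
    simp [unflat, rotMode]

omit M in
/-- Euclidean pairing of two states (`= flat u ⬝ᵥ flat v`). [folklore] -/
def pair (u v : State n) : ℝ := flat u ⬝ᵥ flat v

omit M in
/-- The pairing is the Euclidean one of `ℝⁿ × ℝⁿ × ℝⁿ` («(∇H)ᵀẋ»). [cite: ShinZavala2020, §III-B eq. (13)] -/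
theorem pair_eq (u v : State n) : pair u v = u.1 ⬝ᵥ v.1 + u.2.1 ⬝ᵥ v.2.1 + u.2.2 ⬝ᵥ v.2.2 := by
  simp [pair, flat, dotProduct, Fintype.sum_sum_type, add_assoc]

omit M in
/-- The pairing as one sum over the nodes (the shape of the companion's `pairing_JRmul`).
[cite: ShinZavala2020, §III-B eq. (13)] -/
theorem pair_eq_sum (u v : State n) :
    pair u v = ∑ i, (u.1 i * v.1 i + u.2.1 i * v.2.1 i + u.2.2 i * v.2.2 i) := by
  rw [pair_eq]
  simp only [dotProduct, ← Finset.sum_add_distrib]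

omit M in
/-- [folklore] -/
private theorem pair_comm (u v : State n) : pair u v = pair v u := dotProduct_comm _ _

omit M in
/-- [folklore] -/
private theorem pair_nonneg_self (u : State n) : 0 ≤ pair u u := by
  rw [pair, dotProduct]
  exact Finset.sum_nonneg fun i _ => mul_self_nonneg _

omit M in
/-- [folklore] -/
private theorem pair_self_eq_zero {u : State n} (h : pair u u = 0) : u = 0 := by
  rw [pair, dotProduct] at h
  have h0 : flat u = 0 := by
    funext i
    have := (Finset.sum_eq_zero_iff_of_nonneg (fun j _ => mul_self_nonneg (flat u j))).1 h i
      (Finset.mem_univ i)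
    exact mul_self_eq_zero.1 this
  exact flat_injective (by rw [h0, flat_zero])

/-! ## §2 The model is invariant under the rotation; the flat field and its Jacobian matrix -/

/-- `P_i` depends on the angles only through differences. [cite: SchifferEtAl2014, §5 («the dependence with respect to δ of the dynamics … is via angle differences»)] -/
theorem P_add_const (θ V : Fin n → ℝ) (c : ℝ) : M.P (fun i => θ i + c) V = M.P θ V := by
  ext i; simp [P, add_sub_add_right_eq_sub]

/-- `Q_i` depends on the angles only through differences. [cite: SchifferEtAl2014, §5] -/
theorem Q_add_const (θ V : Fin n → ℝ) (c : ℝ) : M.Q (fun i => θ i + c) V = M.Q θ V := by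
  ext i; simp [Q, add_sub_add_right_eq_sub]

/-- **Rotational invariance of (9)**: `f(θ + c𝟙, ω̃, V) = f(θ, ω̃, V)`.
[cite: SchifferEtAl2014, §5 («the flow … is invariant to a shift in the δ coordinate»)] -/
theorem field_add_constMode (x : State n) (c : ℝ) :
    M.field (x + ((fun _ => c, 0, 0) : State n)) = M.field x := by
  obtain ⟨θ, ω, V⟩ := x
  have hθ : (θ + fun _ => c) = fun i => θ i + c := rfl
  simp only [field, Prod.mk_add_mk, add_zero, hθ, M.P_add_const, M.Q_add_const]

/-- **The field (9) in flat coordinates**: `flatField = flat ∘ f ∘ unflat`. [cite: ShinZavala2020, eq. (9)] -/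
def flatField (y : Idx n → ℝ) : Idx n → ℝ := flat (M.field (unflat y))

/-- [cite: ShinZavala2020, eq. (9)] -/
theorem flatField_flat (x : State n) : M.flatField (flat x) = flat (M.field x) := rfl

/-- Rotational invariance in flat coordinates: `F(y + c·rot) = F(y)`. [cite: SchifferEtAl2014, §5] -/
theorem flatField_add_smul_rotMode (y : Idx n → ℝ) (c : ℝ) :
    M.flatField (y + c • rotMode n) = M.flatField y := by
  simp only [flatField, unflat_add_smul_rotMode, M.field_add_constMode]

/-- **The Jacobian MATRIX `∂f/∂x(x)` of (9) in flat coordinates**: the matrix of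
`v ↦ flat (∂f/∂x(x) (unflat v))`, `∂f/∂x(x)` the Fréchet derivative `jacCLM x` of the companion file.
[cite: ShinZavala2020, Remark 2 («the Jacobian ∂f/∂x(x*,u*) of f(·,u*) evaluated at x*»)] -/
def jacMat (x : State n) : Matrix (Idx n) (Idx n) ℝ :=
  LinearMap.toMatrix'
    ((flatL n).toLinearMap ∘ₗ (M.jacCLM x).toLinearMap ∘ₗ (unflatL n).toLinearMap)

/-- `jacMat x · y = flat (∂f/∂x(x) (unflat y))`. [cite: ShinZavala2020, Remark 2] -/
theorem jacMat_mulVec (x : State n) (y : Idx n → ℝ) :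
    M.jacMat x *ᵥ y = flat (M.jacCLM x (unflat y)) := by
  rw [jacMat, ← Matrix.toLin'_apply, Matrix.toLin'_toMatrix']
  rfl

/-- **Linearisation in flat coordinates**: the flat field is Fréchet differentiable at `flat x` with
derivative the matrix `jacMat x`. [cite: ShinZavala2020, Remark 2 and eq. (9)] -/
theorem hasFDerivAt_flatField (x : State n) :
    HasFDerivAt M.flatField (LinearMap.toContinuousLinearMap (Matrix.toLin' (M.jacMat x)))
      (flat x) := by
  have h1 : HasFDerivAt (unflatL n) (unflatL n) (flat x) := (unflatL n).hasFDerivAt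
  have h2 : HasFDerivAt M.field (M.jacCLM x) (unflatL n (flat x)) := M.hasFDerivAt_field x
  have h3 : HasFDerivAt (flatL n) (flatL n) (M.field (unflatL n (flat x))) := (flatL n).hasFDerivAt
  have h := h3.comp (flat x) (h2.comp (flat x) h1)
  have hF : M.flatField = (flatL n) ∘ M.field ∘ (unflatL n) := rfl
  rw [hF]
  refine h.congr_fderiv (ContinuousLinearMap.ext fun y => ?_)
  rw [LinearMap.coe_toContinuousLinearMap', Matrix.toLin'_apply, jacMat_mulVec]
  rfl

/-! ## §3 Kernel facts of the Hessian (15): `L(x)𝟙 = 0`, `𝟙ᵀW(x) = 0`, `Σ_i ∂P_i = 0`,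
`∇ₓₓH(x)(𝟙,0,0) = 0`; symmetry of `∇ₓₓH(x)`; a left null vector of `∂f/∂x` -/

/-- `L(x)` annihilates constants (zero row sums of the weighted Laplacian).
[cite: ShinZavala2020, eq. (15)] -/
theorem hessL_mulVec_const (x : State n) (c : ℝ) : M.hessL x *ᵥ (fun _ => c) = 0 := by
  ext i
  simp only [hessL, Matrix.sub_mulVec, Pi.sub_apply, Matrix.mulVec_diagonal, Pi.zero_apply]
  simp only [Matrix.mulVec, dotProduct, Matrix.of_apply]
  rw [← Finset.sum_mul]
  ring

/-- Zero column sums of `W(x)` for symmetric `B`: `𝟙ᵀW(x) = 0` (equivalently `Σ_i P_i ≡ 0` for a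
lossless network). [cite: ShinZavala2020, eq. (15); SchifferEtAl2014, §5] -/
theorem const_vecMul_hessW (hB : ∀ i j, M.B i j = M.B j i) (x : State n) (c : ℝ) :
    (fun _ => c) ᵥ* M.hessW x = 0 := by
  ext j
  simp only [hessW, Matrix.vecMul_add, Pi.add_apply, Matrix.vecMul_diagonal, Pi.zero_apply]
  simp only [Matrix.vecMul, dotProduct, Matrix.of_apply]
  rw [← Finset.mul_sum]
  have : ∑ i, M.B i j * x.2.2 i * sin (x.1 i - x.1 j)
      = -∑ k, M.B j k * x.2.2 k * sin (x.1 j - x.1 k) := by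
    rw [← Finset.sum_neg_distrib]
    refine Finset.sum_congr rfl fun i _ => ?_
    rw [hB i j, show x.1 i - x.1 j = -(x.1 j - x.1 i) by ring, Real.sin_neg]
    ring
  rw [this]
  ring

/-- `L(x)` has zero column sums as well (it is symmetric). [cite: ShinZavala2020, eq. (15)] -/
theorem const_vecMul_hessL (hB : ∀ i j, M.B i j = M.B j i) (x : State n) (c : ℝ) :
    (fun _ => c) ᵥ* M.hessL x = 0 := by
  rw [← Matrix.mulVec_transpose, M.hessL_transpose hB]
  exact M.hessL_mulVec_const x c

/-- `W(x)ᵀ` annihilates constants. [cite: ShinZavala2020, eq. (15)] -/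
theorem hessW_transpose_mulVec_const (hB : ∀ i j, M.B i j = M.B j i) (x : State n) (c : ℝ) :
    (M.hessW x)ᵀ *ᵥ (fun _ => c) = 0 := by
  rw [Matrix.mulVec_transpose]
  exact M.const_vecMul_hessW hB x c

/-- **The rotation is in the kernel of the Hessian**: `∇ₓₓH(x)(c𝟙, 0, 0) = 0` (`V_i ≠ 0`).
[cite: ShinZavala2020, eq. (15); SchifferEtAl2014, proof of Prop. 5.9] -/
theorem hessCLM_constMode (hB : ∀ i j, M.B i j = M.B j i) (x : State n) (hV : ∀ i, x.2.2 i ≠ 0)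
    (c : ℝ) : M.hessCLM x ((fun _ => c, 0, 0) : State n) = 0 := by
  rw [M.hessCLM_apply hB x _ hV]
  simp only [Matrix.mulVec_zero, add_zero, M.hessL_mulVec_const, M.hessW_transpose_mulVec_const hB]
  rfl

/-- `Σ_i ∂P_i(v) = 0` (lossless network: `Σ_i P_i ≡ 0`). [cite: ShinZavala2020, eqs. (11a), (15)] -/
theorem sum_dP_eq_zero (hB : ∀ i j, M.B i j = M.B j i) (x v : State n) : ∑ i, M.dP x i v = 0 := by
  have key : ∀ (A : Matrix (Fin n) (Fin n) ℝ) (w : Fin n → ℝ), (fun _ => (1 : ℝ)) ᵥ* A = 0 →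
      ∑ i, (A *ᵥ w) i = 0 := by
    intro A w hA
    have h := Matrix.dotProduct_mulVec (fun _ => (1 : ℝ)) A w
    rw [hA, zero_dotProduct] at h
    simpa [dotProduct] using h
  simp only [M.dP_eq_hess, Finset.sum_add_distrib,
    key _ _ (M.const_vecMul_hessL hB x 1), key _ _ (M.const_vecMul_hessW hB x 1), add_zero]

/-- The left mode `(1/k_P, τ_P/k_P, 0)` of the linearisation. [folklore] -/
def leftMode : State n := (fun i => 1 / M.kP i, fun i => M.τP i / M.kP i, 0)

/-- **A left null vector of `∂f/∂x(x)` at every state**: `(1/k_P, τ_P/k_P, 0)ᵀ ∂f/∂x(x) = 0`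
(because `Σ_i (θ̇_i/k_Pi + τ_Pi ω̃̇_i/k_Pi)` linearises to `−Σ_i ∂P_i = 0`).
[cite: ShinZavala2020, eq. (9); SchifferEtAl2014, §5] -/
theorem pair_leftMode_jacCLM (hB : ∀ i j, M.B i j = M.B j i) (hkP : ∀ i, M.kP i ≠ 0)
    (hτP : ∀ i, M.τP i ≠ 0) (x v : State n) : pair M.leftMode (M.jacCLM x v) = 0 := by
  have hterm : ∀ i, M.leftMode.1 i * (M.jacCLM x v).1 i + M.leftMode.2.1 i * (M.jacCLM x v).2.1 i
      + M.leftMode.2.2 i * (M.jacCLM x v).2.2 i = -M.dP x i v := by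
    intro i
    simp only [leftMode, M.jacCLM_apply, Pi.zero_apply, zero_mul, add_zero]
    field_simp [hkP i, hτP i]
    ring
  rw [pair_eq_sum, Finset.sum_congr rfl fun i _ => hterm i, Finset.sum_neg_distrib,
    M.sum_dP_eq_zero hB, neg_zero]

/-- `A`, `D(u)` are diagonal, hence symmetric. [cite: ShinZavala2020, eqs. (15a)–(15b)] -/
theorem hessA_transpose : M.hessAᵀ = M.hessA := Matrix.diagonal_transpose _

/-- [cite: ShinZavala2020, eq. (15b)] -/
theorem hessD_transpose (x : State n) : (M.hessD x)ᵀ = M.hessD x := Matrix.diagonal_transpose _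

/-- **`∇ₓₓH(x)` is symmetric** (as a Hessian must be): `⟨u, ∇ₓₓH(x)v⟩ = ⟨∇ₓₓH(x)u, v⟩`.
[cite: ShinZavala2020, eq. (15)] -/
theorem pair_hessCLM_comm (hB : ∀ i j, M.B i j = M.B j i) (x : State n) (hV : ∀ i, x.2.2 i ≠ 0)
    (u v : State n) : pair u (M.hessCLM x v) = pair (M.hessCLM x u) v := by
  rw [pair_eq, pair_eq, M.hessCLM_apply hB x v hV, M.hessCLM_apply hB x u hV]
  simp only [dotProduct_add, add_dotProduct, Matrix.dotProduct_mulVec, ← Matrix.mulVec_transpose,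
    Matrix.transpose_transpose, Matrix.transpose_add, M.hessL_transpose hB, M.hessT_transpose hB,
    M.hessA_transpose, M.hessD_transpose]
  ring

/-! ## §4 The spectrum of `∂f/∂x(x*) = (J − R(x*))∇ₓₓH(x*)`: every eigenvalue has negative real part,
except the rotation eigenvalue `0` -/

/-- `(J − R(x))0 = 0`. [cite: ShinZavala2020, eq. (12)] -/
theorem JRmul_zero (x : State n) : M.JRmul x 0 = 0 := by
  refine Prod.ext (funext fun i => ?_) (Prod.ext (funext fun i => ?_) (funext fun i => ?_)) <;>
    simp [JRmul]

omit M in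
/-- [folklore] -/
private theorem sq_terms_eq_zero {c₁ c₂ p q : ℝ} (h₁ : 0 < c₁) (h₂ : 0 < c₂)
    (h : c₁ * p ^ 2 + c₂ * q ^ 2 = 0) : p = 0 ∧ q = 0 := by
  have hp : c₁ * p ^ 2 = 0 := by
    linarith [mul_nonneg h₁.le (sq_nonneg p), mul_nonneg h₂.le (sq_nonneg q)]
  have hq : c₂ * q ^ 2 = 0 := by
    linarith [mul_nonneg h₁.le (sq_nonneg p), mul_nonneg h₂.le (sq_nonneg q)]
  exact ⟨pow_eq_zero_iff two_ne_zero |>.1 ((mul_eq_zero.1 hp).resolve_left h₁.ne'),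
    pow_eq_zero_iff two_ne_zero |>.1 ((mul_eq_zero.1 hq).resolve_left h₂.ne')⟩

/-- **The spectral core, real form.**  At an equilibrium `x*` of (9) with `V* > 0`, positive gains and
time constants, symmetric `B`, and `∇ₓₓH(x*) ⪰ 0` with kernel exactly the rotation `ℝ(𝟙,0,0)`: if
`(σ + iτ, a + ib)` is an eigenpair of `∂f/∂x(x*)` (written as the two real equations), then `σ < 0`,
or `σ = τ = 0` and `a, b` are rotations.  Proof = the linear counterpart of the print's invariance
step: with `Q = ∇ₓₓH(x*)`, `∂f/∂x(x*) = (J − R)Q` (companion `jacCLM_eq_JR_hess_of_equilibrium`) and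
the dissipation identity `wᵀ(J − R)w = −wᵀRw` give `σ·(aᵀQa + bᵀQb) = −(Qa)ᵀR(Qa) − (Qb)ᵀR(Qb) ≤ 0`;
on `σ = 0` the frequency and voltage rows of `Qa, Qb` vanish («the first condition implies
`ω̃ = 0_n` … the second condition implies `V` constant»), whence `Qa = Qb = 0`, i.e. `a, b` rotations.
[cite: SchifferEtAl2014, proof of Proposition 5.9 (eqs. (32)–(38)); ShinZavala2020, eqs. (12)–(13), (15), Remark 2] -/
theorem eig_re_neg_or_rotation (hB : ∀ i j, M.B i j = M.B j i) (hkP : ∀ i, 0 < M.kP i)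
    (hτP : ∀ i, 0 < M.τP i) (hkQ : ∀ i, 0 < M.kQ i) (hτQ : ∀ i, 0 < M.τQ i) {xs : State n}
    (heq : M.field xs = 0) (hV : ∀ i, 0 < xs.2.2 i)
    (hpsd : ∀ v : State n, 0 ≤ pair v (M.hessCLM xs v))
    (hker : ∀ v : State n, pair v (M.hessCLM xs v) = 0 → ∃ a : ℝ, v = (fun _ => a, 0, 0))
    {σ τ : ℝ} {a b : State n} (hab : a ≠ 0 ∨ b ≠ 0)
    (ha : M.jacCLM xs a = σ • a - τ • b) (hb : M.jacCLM xs b = τ • a + σ • b) :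
    σ < 0 ∨ (σ = 0 ∧ τ = 0 ∧ ∃ α β : ℝ, a = (fun _ => α, 0, 0) ∧ b = (fun _ => β, 0, 0)) := by
  have hV0 : ∀ i, xs.2.2 i ≠ 0 := fun i => (hV i).ne'
  have hkP0 : ∀ i, M.kP i ≠ 0 := fun i => (hkP i).ne'
  have hτP0 : ∀ i, M.τP i ≠ 0 := fun i => (hτP i).ne'
  set Q := M.hessCLM xs with hQdef
  have hfac : ∀ v, M.jacCLM xs v = M.JRmul xs (Q v) := fun v =>
    M.jacCLM_eq_JR_hess_of_equilibrium hB xs v hkP0 hτP0 (fun i => (hkQ i).ne')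
      (fun i => (hτQ i).ne') hV0 heq
  -- the dissipation quadratic form of `R(x*)` and the identity `wᵀ(J − R)w = −D(w)`
  set D : State n → ℝ := fun w =>
    ∑ i, (M.kP i / M.τP i ^ 2 * w.2.1 i ^ 2 + M.kQ i * xs.2.2 i / M.τQ i * w.2.2 i ^ 2) with hDdef
  have hc₁ : ∀ i, 0 < M.kP i / M.τP i ^ 2 := fun i => div_pos (hkP i) (pow_pos (hτP i) 2)
  have hc₂ : ∀ i, 0 < M.kQ i * xs.2.2 i / M.τQ i := fun i =>
    div_pos (mul_pos (hkQ i) (hV i)) (hτQ i)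
  have hDnn : ∀ w, 0 ≤ D w := fun w => Finset.sum_nonneg fun i _ =>
    add_nonneg (mul_nonneg (hc₁ i).le (sq_nonneg _)) (mul_nonneg (hc₂ i).le (sq_nonneg _))
  have hDzero : ∀ w, D w = 0 → ∀ i, w.2.1 i = 0 ∧ w.2.2 i = 0 := by
    intro w hw i
    have := (Finset.sum_eq_zero_iff_of_nonneg (fun j _ =>
      add_nonneg (mul_nonneg (hc₁ j).le (sq_nonneg _)) (mul_nonneg (hc₂ j).le (sq_nonneg _)))).1
      hw i (Finset.mem_univ i)
    exact sq_terms_eq_zero (hc₁ i) (hc₂ i) this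
  have hdiss : ∀ w, pair w (M.JRmul xs w) = -D w := fun w => by
    rw [pair_eq_sum]; exact M.pairing_JRmul xs w
  have hsym : ∀ u v, pair u (Q v) = pair (Q u) v := M.pair_hessCLM_comm hB xs hV0
  -- the key identity `σ (aᵀQa + bᵀQb) = −(D(Qa) + D(Qb))`
  have e1 : σ * pair (Q a) a - τ * pair (Q a) b = -D (Q a) := by
    have h := hdiss (Q a)
    rw [← hfac a, ha] at h
    simpa [pair, dotProduct_sub, dotProduct_smul] using h
  have e2 : τ * pair (Q b) a + σ * pair (Q b) b = -D (Q b) := by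
    have h := hdiss (Q b)
    rw [← hfac b, hb] at h
    simpa [pair, dotProduct_add, dotProduct_smul] using h
  have hcross : pair (Q b) a = pair (Q a) b := by rw [pair_comm, hsym a b]
  have hqa : 0 ≤ pair (Q a) a := by rw [pair_comm]; exact hpsd a
  have hqb : 0 ≤ pair (Q b) b := by rw [pair_comm]; exact hpsd b
  have key : σ * (pair (Q a) a + pair (Q b) b) = -(D (Q a) + D (Q b)) := by
    linear_combination e1 + e2 - τ * hcross
  rcases (add_nonneg hqa hqb).lt_or_eq with hqpos | hq0
  · -- `aᵀQa + bᵀQb > 0`: then `σ ≤ 0`, and `σ = 0` is impossible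
    have hσle : σ ≤ 0 := by
      by_contra hσ
      have hσ' : 0 < σ := lt_of_not_ge hσ
      have := mul_pos hσ' hqpos
      linarith [hDnn (Q a), hDnn (Q b)]
    rcases hσle.lt_or_eq with hlt | hσ0
    · exact Or.inl hlt
    exfalso
    have hDa : D (Q a) = 0 := by
      rw [hσ0, zero_mul] at key; linarith [hDnn (Q a), hDnn (Q b)]
    have hDb : D (Q b) = 0 := by
      rw [hσ0, zero_mul] at key; linarith [hDnn (Q a), hDnn (Q b)]
    have hza := hDzero _ hDa
    have hzb := hDzero _ hDb
    -- the eigen-equations with `σ = 0`: `(J − R)Qa = −τ b`, `(J − R)Qb = τ a`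
    have hA : M.JRmul xs (Q a) = -(τ • b) := by rw [← hfac a, ha, hσ0, zero_smul, zero_sub]
    have hBq : M.JRmul xs (Q b) = τ • a := by rw [← hfac b, hb, hσ0, zero_smul, add_zero]
    have rowsA : ∀ i, τ * b.1 i = 0 ∧ τ * b.2.2 i = 0 ∧
        τ * b.2.1 i = M.kP i / M.τP i * (Q a).1 i := by
      intro i
      have h1 := congrFun (congrArg Prod.fst hA) i
      have h2 := congrFun (congrArg (fun p : State n => p.2.1) hA) i
      have h3 := congrFun (congrArg (fun p : State n => p.2.2) hA) i
      simp only [JRmul, Prod.fst_neg, Prod.snd_neg, Pi.neg_apply, Prod.smul_fst, Prod.smul_snd,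
        Pi.smul_apply, smul_eq_mul, (hza i).1, (hza i).2, mul_zero, sub_zero] at h1 h2 h3
      refine ⟨by linarith, ?_, by linarith⟩
      have := h2
      nlinarith [this]
    have rowsB : ∀ i, τ * a.1 i = 0 ∧ τ * a.2.2 i = 0 ∧
        τ * a.2.1 i = -(M.kP i / M.τP i * (Q b).1 i) := by
      intro i
      have h1 := congrFun (congrArg Prod.fst hBq) i
      have h2 := congrFun (congrArg (fun p : State n => p.2.1) hBq) i
      have h3 := congrFun (congrArg (fun p : State n => p.2.2) hBq) i
      simp only [JRmul, Prod.smul_fst, Prod.smul_snd, Pi.smul_apply, smul_eq_mul, (hzb i).1,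
        (hzb i).2, mul_zero, sub_zero] at h1 h2 h3
      refine ⟨by linarith, ?_, by linarith⟩
      linarith
    -- the `ω̃`-rows of `Qa`, `Qb` are `A a_ω̃`, `A b_ω̃`
    have hQω : ∀ (w : State n) i, (Q w).2.1 i = M.τP i / M.kP i * w.2.1 i := by
      intro w i
      have := congrFun (congrArg (fun p : State n => p.2.1) (M.hessCLM_apply hB xs w hV0)) i
      dsimp only at this
      rw [M.hessA_mulVec] at this
      exact this
    rcases eq_or_ne τ 0 with hτ0 | hτ0
    · -- `τ = 0`: then `Qa = Qb = 0`, contradicting `aᵀQa + bᵀQb > 0`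
      have hQa0 : Q a = 0 := by
        refine Prod.ext (funext fun i => ?_) (Prod.ext (funext fun i => ?_) (funext fun i => ?_))
        · have := (rowsA i).2.2
          rw [hτ0, zero_mul] at this
          have hc : M.kP i / M.τP i ≠ 0 := div_ne_zero (hkP0 i) (hτP0 i)
          simpa [hc] using this.symm
        · exact (hza i).1
        · exact (hza i).2
      have hQb0 : Q b = 0 := by
        refine Prod.ext (funext fun i => ?_) (Prod.ext (funext fun i => ?_) (funext fun i => ?_))
        · have := (rowsB i).2.2
          rw [hτ0, zero_mul] at this
          have hc : M.kP i / M.τP i ≠ 0 := div_ne_zero (hkP0 i) (hτP0 i)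
          have : M.kP i / M.τP i * (Q b).1 i = 0 := by linarith
          simpa [hc] using this
        · exact (hzb i).1
        · exact (hzb i).2
      rw [hQa0, hQb0] at hqpos
      simp [pair] at hqpos
    · -- `τ ≠ 0`: then `a, b` have zero angle and voltage parts, and `A a_ω̃ = 0` forces `a = b = 0`
      have ha0 : a = 0 := by
        refine Prod.ext (funext fun i => ?_) (Prod.ext (funext fun i => ?_) (funext fun i => ?_))
        · simpa [hτ0] using (rowsB i).1
        · have h := hQω a i
          rw [(hza i).1] at h
          have hc : M.τP i / M.kP i ≠ 0 := div_ne_zero (hτP0 i) (hkP0 i)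
          simpa [hc] using h.symm
        · simpa [hτ0] using (rowsB i).2.1
      have hb0 : b = 0 := by
        refine Prod.ext (funext fun i => ?_) (Prod.ext (funext fun i => ?_) (funext fun i => ?_))
        · simpa [hτ0] using (rowsA i).1
        · have h := hQω b i
          rw [(hzb i).1] at h
          have hc : M.τP i / M.kP i ≠ 0 := div_ne_zero (hτP0 i) (hkP0 i)
          simpa [hc] using h.symm
        · simpa [hτ0] using (rowsA i).2.1
      exact hab.elim (fun h => h ha0) (fun h => h hb0)
  · -- `aᵀQa + bᵀQb = 0`: both vanish, so `a`, `b` are rotations and `σ = τ = 0`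
    have hqa0 : pair a (Q a) = 0 := by rw [pair_comm]; linarith
    have hqb0 : pair b (Q b) = 0 := by rw [pair_comm]; linarith
    obtain ⟨α, hα⟩ := hker a hqa0
    obtain ⟨β, hβ⟩ := hker b hqb0
    have hQa : Q a = 0 := by rw [hα]; exact M.hessCLM_constMode hB xs hV0 α
    have hQb : Q b = 0 := by rw [hβ]; exact M.hessCLM_constMode hB xs hV0 β
    have hja : σ • a - τ • b = 0 := by rw [← ha, hfac a, hQa, M.JRmul_zero]
    have hjb : τ • a + σ • b = 0 := by rw [← hb, hfac b, hQb, M.JRmul_zero]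
    -- an index exists since `a ≠ 0 ∨ b ≠ 0`
    rcases Nat.eq_zero_or_pos n with hn | hn
    · exfalso
      subst hn
      exact hab.elim (fun h => h (Subsingleton.elim _ _)) (fun h => h (Subsingleton.elim _ _))
    set i₀ : Fin n := ⟨0, hn⟩
    have e1 : σ * α - τ * β = 0 := by
      have := congrFun (congrArg Prod.fst hja) i₀
      simpa [hα, hβ] using this
    have e2 : τ * α + σ * β = 0 := by
      have := congrFun (congrArg Prod.fst hjb) i₀
      simpa [hα, hβ] using this
    have hαβ : 0 < α ^ 2 + β ^ 2 := by
      rcases hab with h | h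
      · have hα0 : α ≠ 0 := by
          rintro rfl
          exact h (by rw [hα]; rfl)
        positivity
      · have hβ0 : β ≠ 0 := by
          rintro rfl
          exact h (by rw [hβ]; rfl)
        positivity
    have hσ : σ * (α ^ 2 + β ^ 2) = 0 := by linear_combination α * e1 + β * e2
    have hτ : τ * (α ^ 2 + β ^ 2) = 0 := by linear_combination (-β) * e1 + α * e2
    exact Or.inr ⟨(mul_eq_zero.1 hσ).resolve_right hαβ.ne', (mul_eq_zero.1 hτ).resolve_right hαβ.ne',
      α, β, hα, hβ⟩

omit M in
/-- Real and imaginary parts of a complex eigen-equation of a real matrix. [folklore] -/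
private theorem mulVec_re_im_of_map_eigen {ι : Type*} [Fintype ι] (A : Matrix ι ι ℝ)
    {μ : ℂ} {v : ι → ℂ} (h : A.map ((↑) : ℝ → ℂ) *ᵥ v = μ • v) :
    (A *ᵥ fun i => (v i).re) = (fun i => μ.re * (v i).re - μ.im * (v i).im) ∧
      (A *ᵥ fun i => (v i).im) = (fun i => μ.re * (v i).im + μ.im * (v i).re) := by
  constructor
  · funext i
    have := congrArg Complex.re (congrFun h i)
    simpa [Matrix.mulVec, dotProduct, Complex.mul_re, Complex.re_sum] using this
  · funext i
    have := congrArg Complex.im (congrFun h i)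
    simpa [Matrix.mulVec, dotProduct, Complex.mul_im, Complex.im_sum] using this

/-- **Spectrum of the linearisation at a «Hessian-stable» equilibrium.**  Under the hypotheses of
`eig_re_neg_or_rotation`, every complex eigenpair `(μ, v)` of the Jacobian matrix `∂f/∂x(x*)`
satisfies `Re μ < 0`, or `μ = 0` and `v` is a complex multiple of the rotation `(𝟙, 0, 0)` — the
print's stability condition (Remark 2: «the Jacobian … is Hurwitz» in the reduced coordinates
`θ_i − θ_n`) in the full angle coordinates. [cite: ShinZavala2020, Remark 2, Prop. 1; SchifferEtAl2014, Proposition 5.9] -/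
theorem jacMat_eig_re_neg_or_rotation (hB : ∀ i j, M.B i j = M.B j i) (hkP : ∀ i, 0 < M.kP i)
    (hτP : ∀ i, 0 < M.τP i) (hkQ : ∀ i, 0 < M.kQ i) (hτQ : ∀ i, 0 < M.τQ i) {xs : State n}
    (heq : M.field xs = 0) (hV : ∀ i, 0 < xs.2.2 i)
    (hpsd : ∀ v : State n, 0 ≤ pair v (M.hessCLM xs v))
    (hker : ∀ v : State n, pair v (M.hessCLM xs v) = 0 → ∃ a : ℝ, v = (fun _ => a, 0, 0))
    {μ : ℂ} {v : Idx n → ℂ} (hv : v ≠ 0)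
    (h : (M.jacMat xs).map ((↑) : ℝ → ℂ) *ᵥ v = μ • v) :
    μ.re < 0 ∨ (μ = 0 ∧ ∃ c : ℂ, v = fun i => c * (rotMode n i : ℂ)) := by
  obtain ⟨hre, him⟩ := mulVec_re_im_of_map_eigen _ h
  set a : State n := unflat fun i => (v i).re with hadef
  set b : State n := unflat fun i => (v i).im with hbdef
  have hfa : flat a = fun i => (v i).re := flat_unflat _
  have hfb : flat b = fun i => (v i).im := flat_unflat _
  have ha : M.jacCLM xs a = μ.re • a - μ.im • b := by
    apply flat_injective
    rw [← unflat_flat a, ← jacMat_mulVec, unflat_flat, flat_sub, flat_smul, flat_smul, hfa, hfb, hre]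
    funext i
    simp
  have hb : M.jacCLM xs b = μ.im • a + μ.re • b := by
    apply flat_injective
    rw [← unflat_flat b, ← jacMat_mulVec, unflat_flat, flat_add, flat_smul, flat_smul, hfa, hfb, him]
    funext i
    simp only [Pi.add_apply, Pi.smul_apply, smul_eq_mul]
    ring
  have hab : a ≠ 0 ∨ b ≠ 0 := by
    by_contra hcon
    simp only [not_or, not_not] at hcon
    apply hv
    funext i
    apply Complex.ext
    · have := congrFun hfa i
      rw [hcon.1, flat_zero] at this
      simpa using this.symm
    · have := congrFun hfb i
      rw [hcon.2, flat_zero] at this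
      simpa using this.symm
  rcases M.eig_re_neg_or_rotation hB hkP hτP hkQ hτQ heq hV hpsd hker hab ha hb with hlt | ⟨hσ, hτ, α, β, hα, hβ⟩
  · exact Or.inl hlt
  · refine Or.inr ⟨Complex.ext (by simpa using hσ) (by simpa using hτ), ⟨α, β⟩, funext fun i => ?_⟩
    have hva : (v i).re = flat a i := (congrFun hfa i).symm
    have hvb : (v i).im = flat b i := (congrFun hfb i).symm
    apply Complex.ext
    · rw [hva, hα]
      rcases i with i | i | i <;> simp [rotMode]
    · rw [hvb, hβ]
      rcases i with i | i | i <;> simp [rotMode]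

/-! ## §5 Local exponential stability modulo the rotation -/

/-- **Schiffer et al. 2014 Prop. 5.9 / Shin–Zavala 2020 Prop. 1 for the model (9), with a rate and
modulo the rotation.**  Let `B` be symmetric, `k_P, τ_P, k_Q, τ_Q > 0`, and let `x* = (θ*, ω̃*, V*)` be
an equilibrium of (9) with `V* > 0` at which the Hessian (15) of the Hamiltonian is positive
semidefinite with kernel exactly the rotation `ℝ(𝟙, 0, 0)` (equivalently: the printed REDUCED Hessian
`∂²H/∂x²(x^s)` of (36), angles relative to a reference node, is positive definite — the print's
condition (31) with Lemma 5.8).  Then there are `ρ, k, λ > 0` such that every solution of (9) on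
`[0, T]` with `‖x(0) − x*‖ < ρ` satisfies, for some rotation `c`,
`‖x(t) − (θ* + c𝟙, ω̃*, V*)‖ ≤ k‖x(0) − x*‖e^{−λt}` on `[0, T]` (sup norms).  In the reduced coordinates
this is local EXPONENTIAL (in particular asymptotic, as printed) stability of `x^s`.  Proof road (not
the print's Lyapunov–LaSalle argument but its linear counterpart): `∂f/∂x(x*) = (J − R(x*))∇ₓₓH(x*)`
(companion file), every eigenvalue has `Re μ < 0` except the simple rotation eigenvalue `0`
(`jacMat_eig_re_neg_or_rotation`), the left null vector `(1/k_P, τ_P/k_P, 0)` makes the projected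
Jacobian equal to the Jacobian, and Lyapunov's indirect method modulo a symmetry direction (the
tree's `Analysis.ODE.exists_expStable_modSymmetry_of_eig_re_neg_or_smul`, Khalil Thm. 4.7 shape) gives
the estimate.  MODELLED column: the port-Hamiltonian droop microgrid `DroopPH` (lossless Kron-reduced
network, first-order filters, constant inputs); no claim about any microgrid outside that model.
[cite: SchifferEtAl2014, §5.3 Proposition 5.9 («Then the equilibrium x^s = col(θ^s, 0_n, V^s) of the system (21)–(22) is locally asymptotically stable») and its proof; ShinZavala2020, §III-C Proposition 1, Remark 2, eqs. (12)–(15); Khalil2002, Theorem 4.7] -/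
theorem expStable_modRotation_of_hessian (hB : ∀ i j, M.B i j = M.B j i) (hkP : ∀ i, 0 < M.kP i)
    (hτP : ∀ i, 0 < M.τP i) (hkQ : ∀ i, 0 < M.kQ i) (hτQ : ∀ i, 0 < M.τQ i) {xs : State n}
    (heq : M.field xs = 0) (hV : ∀ i, 0 < xs.2.2 i)
    (hpsd : ∀ v : State n, 0 ≤ pair v (M.hessCLM xs v))
    (hker : ∀ v : State n, pair v (M.hessCLM xs v) = 0 → ∃ a : ℝ, v = (fun _ => a, 0, 0)) :
    ∃ ρ > 0, ∃ k > 0, ∃ lam > 0, ∀ (X : ℝ → State n) (T : ℝ), M.IsSolutionOn X (Icc 0 T) →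
      ‖X 0 - xs‖ < ρ → ∃ c : ℝ, ∀ t ∈ Icc 0 T,
        ‖X t - (xs + ((fun _ => c, 0, 0) : State n))‖ ≤ k * ‖X 0 - xs‖ * Real.exp (-lam * t) := by
  rcases Nat.eq_zero_or_pos n with hn | hn
  · subst hn
    refine ⟨1, one_pos, 1, one_pos, 1, one_pos, fun X T _ _ => ⟨0, fun t _ => ?_⟩⟩
    have h0 : X t - (xs + ((fun _ => (0 : ℝ), 0, 0) : State 0)) = 0 := Subsingleton.elim _ _
    rw [h0, norm_zero]
    positivity
  haveI : Nonempty (Fin n) := ⟨⟨0, hn⟩⟩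
  have hkP0 : ∀ i, M.kP i ≠ 0 := fun i => (hkP i).ne'
  have hτP0 : ∀ i, M.τP i ≠ 0 := fun i => (hτP i).ne'
  set x₀ : Idx n → ℝ := flat xs with hx₀
  have hf : HasFDerivAt M.flatField
      (LinearMap.toContinuousLinearMap (Matrix.toLin' (M.jacMat xs))) x₀ := M.hasFDerivAt_flatField xs
  have hf0 : M.flatField x₀ = 0 := by
    rw [hx₀, flatField_flat, heq, flat_zero]
  have hsym : ∀ (y : Idx n → ℝ) (c : ℝ), M.flatField (y + c • rotMode n) = M.flatField y :=
    M.flatField_add_smul_rotMode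
  set l : Idx n → ℝ := flat M.leftMode with hl
  have hlJ : l ᵥ* M.jacMat xs = 0 := by
    funext j
    have h := Matrix.dotProduct_mulVec l (M.jacMat xs) (Pi.single j 1)
    rw [dotProduct_single, mul_one] at h
    rw [Pi.zero_apply, ← h, jacMat_mulVec]
    exact M.pair_leftMode_jacCLM hB hkP0 hτP0 xs _
  have hlr : l ⬝ᵥ rotMode n = ∑ i, 1 / M.kP i := by
    simp [hl, leftMode, rotMode, flat, dotProduct, Fintype.sum_sum_type]
  have hlr0 : l ⬝ᵥ rotMode n ≠ 0 := by
    rw [hlr]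
    exact (Finset.sum_pos (fun i _ => one_div_pos.2 (hkP i)) Finset.univ_nonempty).ne'
  have hJ : ∀ (μ : ℂ) (v : Idx n → ℂ), v ≠ 0 →
      ((M.jacMat xs - Matrix.vecMulVec (rotMode n) ((l ⬝ᵥ rotMode n)⁻¹ • (l ᵥ* M.jacMat xs))).map
        ((↑) : ℝ → ℂ)) *ᵥ v = μ • v →
      μ.re < 0 ∨ (μ = 0 ∧ ∃ c : ℂ, v = fun i => c * (rotMode n i : ℂ)) := by
    intro μ v hv h
    rw [hlJ, smul_zero, Matrix.vecMulVec_zero, sub_zero] at h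
    exact M.jacMat_eig_re_neg_or_rotation hB hkP hτP hkQ hτQ heq hV hpsd hker hv h
  obtain ⟨ρ, hρ, k, hk, lam, hlam, H⟩ :=
    Literature.Analysis.ODE.exists_expStable_modSymmetry_of_eig_re_neg_or_smul hf hf0 hsym hlr0 hJ
  refine ⟨ρ, hρ, k, hk, lam, hlam, fun X T hX hX0 => ?_⟩
  have hY : ∀ s ∈ Icc (0 : ℝ) T,
      HasDerivWithinAt (fun s => flat (X s)) (M.flatField (flat (X s))) (Icc 0 T) s := by
    intro s hs
    have h := (flatL n).hasFDerivAt.comp_hasDerivWithinAt s (hX s hs)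
    rw [flatL_apply, ← flatField_flat] at h
    exact h
  have hnorm0 : ‖flat (X 0) - x₀‖ = ‖X 0 - xs‖ := by rw [hx₀, ← flat_sub, norm_flat]
  obtain ⟨c, hc⟩ := H (fun s => flat (X s)) T hY (by rw [hnorm0]; exact hX0)
  refine ⟨c, fun t ht => ?_⟩
  have h := hc t ht
  have e : flat (X t) - (x₀ + c • rotMode n) = flat (X t - (xs + ((fun _ => c, 0, 0) : State n))) := by
    rw [flat_sub, flat_add, flat_constMode]
  rwa [e, norm_flat, hnorm0] at h

/-- **The same, from a positive definite REDUCED Hessian** (the print's hypothesis shape, (31)/(36)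
with a reference node `i₀`): if `vᵀ∇ₓₓH(x*)v > 0` for every nonzero direction `v` with `v_θ,i₀ = 0`,
then `∇ₓₓH(x*) ⪰ 0` with kernel the rotation, and the conclusion of
`expStable_modRotation_of_hessian` holds.
[cite: SchifferEtAl2014, Proposition 5.9 with (31), (36) and Lemma 5.8; ShinZavala2020, Prop. 1 («∇ₓₓH(x*,u) > 0»)] -/
theorem expStable_modRotation_of_reducedHessian_posDef (hB : ∀ i j, M.B i j = M.B j i)
    (hkP : ∀ i, 0 < M.kP i) (hτP : ∀ i, 0 < M.τP i) (hkQ : ∀ i, 0 < M.kQ i) (hτQ : ∀ i, 0 < M.τQ i)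
    {xs : State n} (heq : M.field xs = 0) (hV : ∀ i, 0 < xs.2.2 i) (i₀ : Fin n)
    (hpos : ∀ v : State n, v.1 i₀ = 0 → v ≠ 0 → 0 < pair v (M.hessCLM xs v)) :
    ∃ ρ > 0, ∃ k > 0, ∃ lam > 0, ∀ (X : ℝ → State n) (T : ℝ), M.IsSolutionOn X (Icc 0 T) →
      ‖X 0 - xs‖ < ρ → ∃ c : ℝ, ∀ t ∈ Icc 0 T,
        ‖X t - (xs + ((fun _ => c, 0, 0) : State n))‖ ≤ k * ‖X 0 - xs‖ * Real.exp (-lam * t) := by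
  have hV0 : ∀ i, xs.2.2 i ≠ 0 := fun i => (hV i).ne'
  set Q := M.hessCLM xs with hQdef
  -- gauge: subtract the rotation `v_θ,i₀ (𝟙, 0, 0)`
  have hgauge : ∀ v : State n, pair v (Q v) = pair (v - ((fun _ => v.1 i₀, 0, 0) : State n))
      (Q (v - ((fun _ => v.1 i₀, 0, 0) : State n))) := by
    intro v
    have hQr : Q ((fun _ => v.1 i₀, 0, 0) : State n) = 0 := M.hessCLM_constMode hB xs hV0 _
    have hQv : Q (v - ((fun _ => v.1 i₀, 0, 0) : State n)) = Q v := by rw [map_sub, hQr, sub_zero]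
    rw [hQv]
    have hr : pair ((fun _ => v.1 i₀, 0, 0) : State n) (Q v) = 0 := by
      rw [M.pair_hessCLM_comm hB xs hV0, hQr]
      simp [pair]
    have : pair (v - ((fun _ => v.1 i₀, 0, 0) : State n)) (Q v)
        = pair v (Q v) - pair ((fun _ => v.1 i₀, 0, 0) : State n) (Q v) := by
      simp [pair, sub_dotProduct]
    rw [this, hr, sub_zero]
  have hpsd : ∀ v : State n, 0 ≤ pair v (Q v) := by
    intro v
    rw [hgauge v]
    by_cases hw : v - ((fun _ => v.1 i₀, 0, 0) : State n) = 0
    · rw [hw]; simp [pair]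
    · exact (hpos _ (by simp) hw).le
  have hker : ∀ v : State n, pair v (Q v) = 0 → ∃ a : ℝ, v = (fun _ => a, 0, 0) := by
    intro v hv
    rw [hgauge v] at hv
    by_cases hw : v - ((fun _ => v.1 i₀, 0, 0) : State n) = 0
    · exact ⟨v.1 i₀, (sub_eq_zero.1 hw)⟩
    · exact absurd hv (hpos _ (by simp) hw).ne'
  exact M.expStable_modRotation_of_hessian hB hkP hτP hkQ hτQ heq hV hpsd hker

/-! ## §6 The hypothesis in the print's matrix shape: the `(θ, V)`-block (36) of the Hessian,
positive definite in a reference gauge; and the Lemma 5.8 analogue `L(x*)𝟙^⊥ ≻ 0` (append; same sources) -/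

/-- **The `(θ, V)`-block of the Hessian (15)/(35)** in full angle coordinates:
`[L(x) W(x); W(x)ᵀ D(u) + T(x)]` — the print's matrix (36) before passing to the `n − 1` relative
angles (its `ω̃`-block `A = diag(τ_P/k_P)` splits off). [cite: SchifferEtAl2014, proof of Proposition 5.9, eqs. (35)–(36); ShinZavala2020, eqs. (15)–(16)] -/
def hessThetaV (x : State n) : Matrix (Fin n ⊕ Fin n) (Fin n ⊕ Fin n) ℝ :=
  Matrix.fromBlocks (M.hessL x) (M.hessW x) (M.hessW x)ᵀ (M.hessD x + M.hessT x)

/-- **Block decomposition of the Hessian quadratic form**: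
`vᵀ∇ₓₓH(x)v = (v_θ, v_V)ᵀ [L W; Wᵀ D+T] (v_θ, v_V) + v_ω̃ᵀ A v_ω̃` (`V_i ≠ 0`, `B` symmetric).
[cite: SchifferEtAl2014, proof of Proposition 5.9, (35)–(36) («the Hessian is positive definite if and only if the submatrix (36) is positive definite»); ShinZavala2020, eq. (15)] -/
theorem pair_hessCLM_eq_blocks (hB : ∀ i j, M.B i j = M.B j i) (x : State n)
    (hV : ∀ i, x.2.2 i ≠ 0) (v : State n) :
    pair v (M.hessCLM x v)
      = Sum.elim v.1 v.2.2 ⬝ᵥ (M.hessThetaV x *ᵥ Sum.elim v.1 v.2.2) + v.2.1 ⬝ᵥ (M.hessA *ᵥ v.2.1) := by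
  rw [pair_eq, M.hessCLM_apply hB x v hV, hessThetaV, Matrix.fromBlocks_mulVec, Sum.elim_comp_inl,
    Sum.elim_comp_inr, sumElim_dotProduct_sumElim]
  ring

/-- **Schiffer et al. Prop. 5.9 in the print's hypothesis shape.**  `B` symmetric, positive gains and
time constants, `x*` an equilibrium of (9) with `V* > 0`, and the `(θ, V)`-block (36) of the Hessian
positive definite on the directions with `v_θ,i₀ = 0` (reference node `i₀`; equivalently the printed
`(3n − 1)`-dimensional Hessian `∂²H/∂x²(x^s)` of (35) is positive definite, i.e. condition (31) given
Lemma 5.8): then the conclusion of `expStable_modRotation_of_hessian` holds — local exponential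
stability of `x*` modulo the rotation.  (`A = diag(τ_P/k_P) ≻ 0` takes care of the `ω̃`-block,
companion `hessA_quadForm_pos`.)
[cite: SchifferEtAl2014, §5.3 Proposition 5.9 with (31), (35)–(36); ShinZavala2020, Prop. 1, eq. (15)] -/
theorem expStable_modRotation_of_thetaVBlock_posDef (hB : ∀ i j, M.B i j = M.B j i)
    (hkP : ∀ i, 0 < M.kP i) (hτP : ∀ i, 0 < M.τP i) (hkQ : ∀ i, 0 < M.kQ i) (hτQ : ∀ i, 0 < M.τQ i)
    {xs : State n} (heq : M.field xs = 0) (hV : ∀ i, 0 < xs.2.2 i) (i₀ : Fin n)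
    (h36 : ∀ y : Fin n ⊕ Fin n → ℝ, y (Sum.inl i₀) = 0 → y ≠ 0 → 0 < y ⬝ᵥ (M.hessThetaV xs *ᵥ y)) :
    ∃ ρ > 0, ∃ k > 0, ∃ lam > 0, ∀ (X : ℝ → State n) (T : ℝ), M.IsSolutionOn X (Icc 0 T) →
      ‖X 0 - xs‖ < ρ → ∃ c : ℝ, ∀ t ∈ Icc 0 T,
        ‖X t - (xs + ((fun _ => c, 0, 0) : State n))‖ ≤ k * ‖X 0 - xs‖ * Real.exp (-lam * t) := by
  have hV0 : ∀ i, xs.2.2 i ≠ 0 := fun i => (hV i).ne'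
  refine M.expStable_modRotation_of_reducedHessian_posDef hB hkP hτP hkQ hτQ heq hV i₀ ?_
  intro v hv0 hv
  rw [M.pair_hessCLM_eq_blocks hB xs hV0 v]
  have hA : 0 ≤ v.2.1 ⬝ᵥ (M.hessA *ᵥ v.2.1) := by
    simp only [dotProduct, M.hessA_mulVec]
    exact Finset.sum_nonneg fun i _ => by
      have := div_pos (hτP i) (hkP i)
      nlinarith [sq_nonneg (v.2.1 i)]
  by_cases hy : Sum.elim v.1 v.2.2 = 0
  · -- then `v_ω̃ ≠ 0` and the `A`-block is positive
    have hω : v.2.1 ≠ 0 := by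
      intro hω
      apply hv
      have h1 : v.1 = 0 := by
        funext i; exact congrFun hy (Sum.inl i)
      have h3 : v.2.2 = 0 := by
        funext i; exact congrFun hy (Sum.inr i)
      exact Prod.ext h1 (Prod.ext hω h3)
    rw [hy, Matrix.mulVec_zero, dotProduct_zero, zero_add]
    exact M.hessA_quadForm_pos hτP hkP hω
  · have := h36 (Sum.elim v.1 v.2.2) (by simpa using hv0) hy
    linarith

/-- `L(x)` is minus the susceptance-type Laplacian of the weights `c_ij = B_ij V_i V_j cos θ_ij`
(`i ≠ j`): its quadratic form vanishes exactly on the constants when the coupling graph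
`{B_ij > 0}` is connected and the equilibrium is strictly phase cohesive with `V > 0` — the full-angle
form of **Lemma 5.8** («under the standing assumptions, L is positive definite» for the reduced `L`).
Hypotheses: `B` symmetric with off-diagonal entries `≥ 0`, `CouplingConnected B`, `|θ_i − θ_j| < π/2`
across every line `B_ij > 0`, `|θ_i − θ_j| ≤ π/2` for all pairs, `V_i > 0`.
[cite: SchifferEtAl2014, §5.3 Lemma 5.8 and Assumption 5.4; ShinZavala2020, §IV-B («L̃(x̃) is PD if θ ∈ Θ_G(π/2) because L̃(x̃) is a reduced Laplacian»)] -/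
theorem hessL_quadForm_eq_zero_iff (hB : ∀ i j, M.B i j = M.B j i)
    (hBnn : ∀ i j, i ≠ j → 0 ≤ M.B i j) (hconn : ClassicalModel.CouplingConnected M.B)
    (x : State n) (hV : ∀ i, 0 < x.2.2 i) (hθ : ∀ i j, |x.1 i - x.1 j| ≤ π / 2)
    (hcoh : ∀ i j, i ≠ j → 0 < M.B i j → |x.1 i - x.1 j| < π / 2) (u : Fin n → ℝ) :
    u ⬝ᵥ (M.hessL x *ᵥ u) = 0 ↔ ∃ c : ℝ, u = fun _ => c := by
  constructor
  · intro hu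
    rw [M.hessL_quadForm hB] at hu
    have hw : ∀ i j, 0 ≤ M.B i j * x.2.2 i * x.2.2 j * cos (x.1 i - x.1 j) * (u i - u j) ^ 2 := by
      intro i j
      by_cases h : i = j
      · subst h; simp
      · exact mul_nonneg (mul_nonneg (mul_nonneg (mul_nonneg (hBnn i j h) (hV i).le) (hV j).le)
          (Real.cos_nonneg_of_mem_Icc ⟨(abs_le.1 (hθ i j)).1, (abs_le.1 (hθ i j)).2⟩)) (sq_nonneg _)
    have hsum : ∑ i, ∑ j, M.B i j * x.2.2 i * x.2.2 j * cos (x.1 i - x.1 j) * (u i - u j) ^ 2 = 0 := by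
      linarith
    have hterm : ∀ i j, M.B i j * x.2.2 i * x.2.2 j * cos (x.1 i - x.1 j) * (u i - u j) ^ 2 = 0 := by
      intro i j
      have hrow := (Finset.sum_eq_zero_iff_of_nonneg fun i _ =>
        Finset.sum_nonneg fun j _ => hw i j).1 hsum i (Finset.mem_univ i)
      exact (Finset.sum_eq_zero_iff_of_nonneg fun j _ => hw i j).1 hrow j (Finset.mem_univ j)
    have hlines : ∀ i j, i ≠ j → 0 < M.B i j → u i - u j = (0 : Fin n → ℝ) i - (0 : Fin n → ℝ) j := by
      intro i j hij hBij
      have hcos : 0 < cos (x.1 i - x.1 j) :=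
        Real.cos_pos_of_mem_Ioo ⟨(abs_lt.1 (hcoh i j hij hBij)).1, (abs_lt.1 (hcoh i j hij hBij)).2⟩
      have hc : 0 < M.B i j * x.2.2 i * x.2.2 j * cos (x.1 i - x.1 j) :=
        mul_pos (mul_pos (mul_pos hBij (hV i)) (hV j)) hcos
      have h0 := hterm i j
      rcases mul_eq_zero.1 h0 with h | h
      · exact absurd h hc.ne'
      · have : u i - u j = 0 := pow_eq_zero_iff two_ne_zero |>.1 h
        simpa using this
    obtain ⟨c, hc⟩ := ClassicalModel.exists_const_of_lineAngles_eq hconn hlines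
    exact ⟨c, funext fun i => by simpa using hc i⟩
  · rintro ⟨c, rfl⟩
    rw [M.hessL_mulVec_const, dotProduct_zero]

/-! ## §7 Shin–Zavala's Schur-complement form (16) of the Hessian condition (append; same sources) -/

/-- **The Schur complement (16)** of the `V`-block in the `(θ, V)`-block (36), in full angle
coordinates: `S(x) = L(x) − W(x)(D(u) + T(x))⁻¹W(x)ᵀ` (`n × n`, with `S(x)𝟙 = 0`; the print's `S` is
its restriction to the `n − 1` relative angles, and the printed `W(x)ᵀ(D + T)⁻¹W(x)` has the
transpose on the wrong factor for the stated dimensions `W ∈ ℝ^{(n−1)×n}`).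
[cite: ShinZavala2020, §IV-A eq. (16) («the Hessian is PD if and only if the Schur complement S(x,u) := L(x) − W(x)ᵀ(D(u) + T(x))⁻¹W(x) is PD»)] -/
def schurS (x : State n) : Matrix (Fin n) (Fin n) ℝ :=
  M.hessL x - M.hessW x * (M.hessD x + M.hessT x)⁻¹ * (M.hessW x)ᵀ

/-- **Completing the square in the `(θ, V)`-block**: for `D(u) + T(x) ≻ 0`,
`(y_θ, y_V)ᵀ [L W; Wᵀ D+T] (y_θ, y_V) = zᵀ(D + T)z + y_θᵀ S(x) y_θ` with `z = (D + T)⁻¹Wᵀy_θ + y_V`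
(Mathlib's `Matrix.schur_complement_eq₂₂`). [cite: ShinZavala2020, §IV-A eq. (16)] -/
theorem hessThetaV_quadForm_eq_schur (x : State n) (hDT : (M.hessD x + M.hessT x).PosDef)
    (yθ yV : Fin n → ℝ) :
    Sum.elim yθ yV ⬝ᵥ (M.hessThetaV x *ᵥ Sum.elim yθ yV)
      = (((M.hessD x + M.hessT x)⁻¹ * (M.hessW x)ᵀ) *ᵥ yθ + yV) ⬝ᵥ
          ((M.hessD x + M.hessT x) *ᵥ (((M.hessD x + M.hessT x)⁻¹ * (M.hessW x)ᵀ) *ᵥ yθ + yV))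
        + yθ ⬝ᵥ (M.schurS x *ᵥ yθ) := by
  have hHerm : (M.hessD x + M.hessT x).IsHermitian := hDT.1
  letI : Invertible (M.hessD x + M.hessT x) := hDT.isUnit.invertible
  have h := Matrix.schur_complement_eq₂₂ (M.hessL x) (M.hessW x) yθ yV hHerm
  simp only [star_trivial, Matrix.conjTranspose_eq_transpose_of_trivial,
    ← Matrix.dotProduct_mulVec] at h
  exact h

/-- **Schiffer et al. Prop. 5.9 / Shin–Zavala Prop. 1 from the Schur-complement condition (16).**
`B` symmetric, positive gains and time constants, `x*` an equilibrium of (9) with `V* > 0`,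
`D(u) + T(x*) ≻ 0`, and the Schur complement `S(x*)` positive definite on the directions with
`y_i₀ = 0` (reference node; = the print's reduced `S(x*, u) ≻ 0`): then `x*` is locally
exponentially stable modulo the rotation (conclusion of `expStable_modRotation_of_hessian`).
[cite: ShinZavala2020, §IV-A eq. (16) with Prop. 1 and Remark 2; SchifferEtAl2014, §5.3 Proposition 5.9] -/
theorem expStable_modRotation_of_schur_posDef (hB : ∀ i j, M.B i j = M.B j i)
    (hkP : ∀ i, 0 < M.kP i) (hτP : ∀ i, 0 < M.τP i) (hkQ : ∀ i, 0 < M.kQ i) (hτQ : ∀ i, 0 < M.τQ i)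
    {xs : State n} (heq : M.field xs = 0) (hV : ∀ i, 0 < xs.2.2 i) (i₀ : Fin n)
    (hDT : (M.hessD xs + M.hessT xs).PosDef)
    (hS : ∀ y : Fin n → ℝ, y i₀ = 0 → y ≠ 0 → 0 < y ⬝ᵥ (M.schurS xs *ᵥ y)) :
    ∃ ρ > 0, ∃ k > 0, ∃ lam > 0, ∀ (X : ℝ → State n) (T : ℝ), M.IsSolutionOn X (Icc 0 T) →
      ‖X 0 - xs‖ < ρ → ∃ c : ℝ, ∀ t ∈ Icc 0 T,
        ‖X t - (xs + ((fun _ => c, 0, 0) : State n))‖ ≤ k * ‖X 0 - xs‖ * Real.exp (-lam * t) := by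
  refine M.expStable_modRotation_of_thetaVBlock_posDef hB hkP hτP hkQ hτQ heq hV i₀ ?_
  intro y hy0 hy
  set yθ : Fin n → ℝ := fun i => y (Sum.inl i) with hyθ
  set yV : Fin n → ℝ := fun i => y (Sum.inr i) with hyV
  have hyy : y = Sum.elim yθ yV := by
    ext (i | i) <;> rfl
  set z : Fin n → ℝ := ((M.hessD xs + M.hessT xs)⁻¹ * (M.hessW xs)ᵀ) *ᵥ yθ + yV with hz
  have hz0 : 0 ≤ z ⬝ᵥ ((M.hessD xs + M.hessT xs) *ᵥ z) := by
    have := hDT.posSemidef.dotProduct_mulVec_nonneg z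
    rwa [star_trivial] at this
  rw [hyy, M.hessThetaV_quadForm_eq_schur xs hDT]
  by_cases hθ : yθ = 0
  · -- `y_θ = 0`: then `y_V ≠ 0`, `z = y_V` and the `D + T` term is positive
    have hV0 : yV ≠ 0 := by
      intro h0
      apply hy
      rw [hyy, hθ, h0]
      ext (i | i) <;> rfl
    have hzV : z = yV := by rw [hz, hθ, Matrix.mulVec_zero, zero_add]
    have hpos : 0 < z ⬝ᵥ ((M.hessD xs + M.hessT xs) *ᵥ z) := by
      have := hDT.dotProduct_mulVec_pos (show z ≠ 0 by rwa [hzV])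
      rwa [star_trivial] at this
    have h2 : yθ ⬝ᵥ (M.schurS xs *ᵥ yθ) = 0 := by rw [hθ, zero_dotProduct]
    rw [h2, add_zero]
    exact hpos
  · have hSpos := hS yθ (by simpa [hyθ] using hy0) hθ
    exact add_pos_of_nonneg_of_pos hz0 hSpos

/-! ## §8 Solutions EXIST from every nearby initial state and converge exponentially to a rotated
equilibrium (append): the field (9) is `C¹`, solutions are confined by the estimate, Teschl Cor. 2.15 -/

section Existence

open Metric

/-- The active power flows are `C¹` functions of the state. [cite: ShinZavala2020, §III-A (power flow equations after (8))] -/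
theorem contDiff_P (i : Fin n) : ContDiff ℝ 1 fun x : State n => M.P x.1 x.2.2 i := by
  have hθ : ∀ k, ContDiff ℝ 1 fun x : State n => x.1 k := fun k =>
    (contDiff_apply ℝ ℝ k).comp contDiff_fst
  have hV : ∀ k, ContDiff ℝ 1 fun x : State n => x.2.2 k := fun k =>
    (contDiff_apply ℝ ℝ k).comp (contDiff_snd.comp contDiff_snd)
  unfold P
  exact ContDiff.sum fun j _ =>
    (((hV i).mul (hV j)).mul contDiff_const).mul (((hθ i).sub (hθ j)).sin)

/-- The reactive power flows are `C¹` functions of the state. [cite: ShinZavala2020, §III-A (power flow equations after (8))] -/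
theorem contDiff_Q (i : Fin n) : ContDiff ℝ 1 fun x : State n => M.Q x.1 x.2.2 i := by
  have hθ : ∀ k, ContDiff ℝ 1 fun x : State n => x.1 k := fun k =>
    (contDiff_apply ℝ ℝ k).comp contDiff_fst
  have hV : ∀ k, ContDiff ℝ 1 fun x : State n => x.2.2 k := fun k =>
    (contDiff_apply ℝ ℝ k).comp (contDiff_snd.comp contDiff_snd)
  unfold Q
  exact (ContDiff.sum fun j _ =>
    (((hV i).mul (hV j)).mul contDiff_const).mul (((hθ i).sub (hθ j)).cos)).neg

/-- **The field (9) is `C¹` on the whole state space** (polynomial–trigonometric).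
[cite: ShinZavala2020, eq. (9)] -/
theorem contDiff_field : ContDiff ℝ 1 M.field := by
  have hω : ∀ k, ContDiff ℝ 1 fun x : State n => x.2.1 k := fun k =>
    (contDiff_apply ℝ ℝ k).comp (contDiff_fst.comp contDiff_snd)
  have hV : ∀ k, ContDiff ℝ 1 fun x : State n => x.2.2 k := fun k =>
    (contDiff_apply ℝ ℝ k).comp (contDiff_snd.comp contDiff_snd)
  unfold field
  refine (contDiff_pi.2 fun i => hω i).prodMk
    ((contDiff_pi.2 fun i => ?_).prodMk (contDiff_pi.2 fun i => ?_))
  · exact ((hω i).neg.sub (contDiff_const.mul ((M.contDiff_P i).sub contDiff_const))).div_const _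
  · exact ((hV i).neg.sub (contDiff_const.mul ((M.contDiff_Q i).sub contDiff_const))).div_const _

/-- **Schiffer et al. Prop. 5.9 / Shin–Zavala Prop. 1 as a statement about trajectories from initial
data (EXISTENCE + convergence).**  Under the hypotheses of `expStable_modRotation_of_hessian` there
are `ρ, k, λ > 0` such that from EVERY initial state `x₀` with `‖x₀ − x*‖ < ρ` the model (9) has a
solution `x(·)` on `[0, ∞)` with `x(0) = x₀`, and for some rotation `c`,
`‖x(t) − (θ* + c𝟙, ω̃*, V*)‖ ≤ k‖x₀ − x*‖e^{−λt}` for all `t ≥ 0` («all trajectories … converge to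
[a rotation of the equilibrium]»).  Proof: the field is `C¹` (`contDiff_field`); by the estimate of
`expStable_modRotation_of_hessian` every solution from `x₀` on any `[0, s]` stays in the compact ball
`‖x − x*‖ ≤ (2k + 1)‖x₀ − x*‖`; a `C¹` field with confined solutions has global solutions (the tree's
`Analysis.ODE.exists_global_solution_of_confined`, Teschl Cor. 2.15); the rotations `c_N` given by the
estimate on `[0, N]` are bounded, and a limit point serves for all `t ≥ 0`.
[cite: SchifferEtAl2014, §5 («all trajectories of the system … converge to the synchronized motion (17) (up to a uniform shift of all angles)») and Proposition 5.9; ShinZavala2020, §III-C Proposition 1; Khalil2002, Theorem 4.7] -/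
theorem exists_solution_expStable_modRotation (hB : ∀ i j, M.B i j = M.B j i)
    (hkP : ∀ i, 0 < M.kP i) (hτP : ∀ i, 0 < M.τP i) (hkQ : ∀ i, 0 < M.kQ i) (hτQ : ∀ i, 0 < M.τQ i)
    {xs : State n} (heq : M.field xs = 0) (hV : ∀ i, 0 < xs.2.2 i)
    (hpsd : ∀ v : State n, 0 ≤ pair v (M.hessCLM xs v))
    (hker : ∀ v : State n, pair v (M.hessCLM xs v) = 0 → ∃ a : ℝ, v = (fun _ => a, 0, 0)) :
    ∃ ρ > 0, ∃ k > 0, ∃ lam > 0, ∀ x₀ : State n, ‖x₀ - xs‖ < ρ →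
      ∃ X : ℝ → State n, X 0 = x₀ ∧ (∀ T : ℝ, M.IsSolutionOn X (Icc 0 T)) ∧
        ∃ c : ℝ, ∀ t : ℝ, 0 ≤ t →
          ‖X t - (xs + ((fun _ => c, 0, 0) : State n))‖ ≤ k * ‖x₀ - xs‖ * Real.exp (-lam * t) := by
  rcases Nat.eq_zero_or_pos n with hn | hn
  · subst hn
    refine ⟨1, one_pos, 1, one_pos, 1, one_pos, fun x₀ _ => ⟨fun _ => x₀, rfl, fun T t _ => ?_,
      0, fun t _ => ?_⟩⟩
    · have h0 : M.field x₀ = 0 := Subsingleton.elim _ _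
      rw [h0]
      exact hasDerivWithinAt_const _ _ _
    · have h0 : x₀ - (xs + ((fun _ => (0 : ℝ), 0, 0) : State 0)) = 0 := Subsingleton.elim _ _
      rw [h0, norm_zero]
      positivity
  haveI : Nonempty (Fin n) := ⟨⟨0, hn⟩⟩
  obtain ⟨ρ, hρ, k, hk, lam, hlam, H⟩ :=
    M.expStable_modRotation_of_hessian hB hkP hτP hkQ hτQ heq hV hpsd hker
  refine ⟨ρ, hρ, k, hk, lam, hlam, fun x₀ hx₀ => ?_⟩
  -- confinement to a compact ball by the estimate
  set K : Set (State n) := closedBall xs ((2 * k + 1) * ‖x₀ - xs‖) with hKdef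
  have hconf : ∀ s : ℝ, ∀ X : ℝ → State n, X 0 = x₀ →
      (∀ t ∈ Icc 0 s, HasDerivWithinAt X (M.field (X t)) (Icc 0 s) t) →
      ∀ t ∈ Icc 0 s, X t ∈ K := by
    intro s X hX0 hX t ht
    obtain ⟨c, hc⟩ := H X s hX (by rw [hX0]; exact hx₀)
    have hs0 : (0 : ℝ) ∈ Icc 0 s := ⟨le_rfl, ht.1.trans ht.2⟩
    have h0 := hc 0 hs0
    have h1 := hc t ht
    rw [hX0] at h0 h1
    rw [mul_zero, Real.exp_zero, mul_one] at h0
    have hexp : Real.exp (-lam * t) ≤ 1 := Real.exp_le_one_iff.2 (by nlinarith [ht.1])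
    have h1' : ‖X t - (xs + ((fun _ => c, 0, 0) : State n))‖ ≤ k * ‖x₀ - xs‖ :=
      h1.trans (mul_le_of_le_one_right (by positivity) hexp)
    -- size of the rotation from the estimate at `t = 0`
    have hcn : ‖((fun _ => c, 0, 0) : State n)‖ ≤ (k + 1) * ‖x₀ - xs‖ := by
      have e : ((fun _ => c, 0, 0) : State n)
          = (x₀ - xs) - (x₀ - (xs + ((fun _ => c, 0, 0) : State n))) := by abel
      calc ‖((fun _ => c, 0, 0) : State n)‖
          = ‖(x₀ - xs) - (x₀ - (xs + ((fun _ => c, 0, 0) : State n)))‖ := by rw [← e]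
        _ ≤ ‖x₀ - xs‖ + ‖x₀ - (xs + ((fun _ => c, 0, 0) : State n))‖ := norm_sub_le _ _
        _ ≤ ‖x₀ - xs‖ + k * ‖x₀ - xs‖ := by linarith
        _ = (k + 1) * ‖x₀ - xs‖ := by ring
    rw [hKdef, mem_closedBall, dist_eq_norm]
    have e2 : X t - xs = (X t - (xs + ((fun _ => c, 0, 0) : State n))) + ((fun _ => c, 0, 0) : State n) := by
      abel
    calc ‖X t - xs‖ ≤ ‖X t - (xs + ((fun _ => c, 0, 0) : State n))‖ + ‖((fun _ => c, 0, 0) : State n)‖ := by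
          rw [e2]; exact norm_add_le _ _
      _ ≤ k * ‖x₀ - xs‖ + (k + 1) * ‖x₀ - xs‖ := add_le_add h1' hcn
      _ = (2 * k + 1) * ‖x₀ - xs‖ := by ring
  obtain ⟨X, hX0, hX⟩ := Literature.Analysis.ODE.exists_global_solution_of_confined isOpen_univ
    M.contDiff_field.contDiffOn (isCompact_closedBall _ _) (Set.subset_univ _) hconf
  refine ⟨X, hX0, fun T => hX T, ?_⟩
  -- rotations from the estimate on `[0, N]`, bounded; a limit point works for all `t ≥ 0`
  have hcN : ∀ N : ℕ, ∃ c : ℝ, c ∈ Icc (-((k + 1) * ‖x₀ - xs‖)) ((k + 1) * ‖x₀ - xs‖) ∧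
      ∀ t ∈ Icc (0 : ℝ) N, ‖X t - (xs + ((fun _ => c, 0, 0) : State n))‖
        ≤ k * ‖x₀ - xs‖ * Real.exp (-lam * t) := by
    intro N
    obtain ⟨c, hc⟩ := H X N (hX N) (by rw [hX0]; exact hx₀)
    refine ⟨c, ?_, fun t ht => by rw [← hX0]; exact hc t ht⟩
    have h0 := hc 0 ⟨le_rfl, Nat.cast_nonneg N⟩
    rw [hX0, mul_zero, Real.exp_zero, mul_one] at h0
    have hc' : |c| ≤ (k + 1) * ‖x₀ - xs‖ := by
      have hcn : |c| ≤ ‖((fun _ => c, 0, 0) : State n)‖ := by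
        have := norm_fst_le ((fun _ => c, 0, 0) : State n)
        rw [pi_norm_const] at this
        exact le_of_eq_of_le (Real.norm_eq_abs c).symm this
      have e : ((fun _ => c, 0, 0) : State n)
          = (x₀ - xs) - (x₀ - (xs + ((fun _ => c, 0, 0) : State n))) := by abel
      calc |c| ≤ ‖((fun _ => c, 0, 0) : State n)‖ := hcn
        _ = ‖(x₀ - xs) - (x₀ - (xs + ((fun _ => c, 0, 0) : State n)))‖ := by rw [← e]
        _ ≤ ‖x₀ - xs‖ + ‖x₀ - (xs + ((fun _ => c, 0, 0) : State n))‖ := norm_sub_le _ _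
        _ ≤ ‖x₀ - xs‖ + k * ‖x₀ - xs‖ := by linarith
        _ = (k + 1) * ‖x₀ - xs‖ := by ring
    exact ⟨by linarith [(abs_le.1 hc').1], (abs_le.1 hc').2⟩
  choose c hcb hcest using hcN
  obtain ⟨cstar, -, φ, hφ, hlim⟩ := tendsto_subseq_of_bounded (isBounded_Icc _ _) hcb
  refine ⟨cstar, fun t ht => ?_⟩
  have hev : ∀ᶠ m in Filter.atTop, ‖X t - (xs + ((fun _ => c (φ m), 0, 0) : State n))‖
      ≤ k * ‖x₀ - xs‖ * Real.exp (-lam * t) := by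
    obtain ⟨N₀, hN₀⟩ := exists_nat_ge t
    filter_upwards [Filter.eventually_ge_atTop N₀] with m hm
    refine hcest (φ m) t ⟨ht, hN₀.trans ?_⟩
    exact_mod_cast hm.trans (hφ.id_le m)
  have hcont : Continuous fun a : ℝ => ‖X t - (xs + ((fun _ => a, 0, 0) : State n))‖ := by
    refine (continuous_const.sub (continuous_const.add ?_)).norm
    exact (continuous_pi fun _ => continuous_id).prodMk continuous_const
  exact le_of_tendsto ((hcont.tendsto cstar).comp hlim) hev

end Existence

/-! ## §9 The Hessian test is sharp: a direction of negative curvature of `H` at the equilibrium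
excludes convergence (append) -/

section NegativeCurvature

open _root_.Filter Metric
open scoped _root_.Topology

/-- `Σ_i P_i = 0`: a lossless network neither generates nor absorbs active power in total
(antisymmetry of `V_iV_jB_ij sin θ_ij` for symmetric `B`). [cite: SchifferEtAl2014, §5 (synchronised frequency from `Σ_i P_i`); ShinZavala2020, §III-A] -/
theorem sum_P_eq_zero (hB : ∀ i j, M.B i j = M.B j i) (θ V : Fin n → ℝ) : ∑ i, M.P θ V i = 0 := by
  have h : ∑ i, ∑ j, V i * V j * M.B i j * sin (θ i - θ j)
      = -∑ i, ∑ j, V i * V j * M.B i j * sin (θ i - θ j) := by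
    conv_rhs => rw [Finset.sum_comm]
    rw [← Finset.sum_neg_distrib]
    refine Finset.sum_congr rfl fun i _ => ?_
    rw [← Finset.sum_neg_distrib]
    refine Finset.sum_congr rfl fun j _ => ?_
    rw [hB j i, show θ j - θ i = -(θ i - θ j) by ring, Real.sin_neg]
    ring
  have h2 : ∑ i, M.P θ V i = ∑ i, ∑ j, V i * V j * M.B i j * sin (θ i - θ j) := rfl
  linarith

/-- **`H` under the rotation**: `H(θ + c𝟙, ω̃, V) = H(θ, ω̃, V) − cΣ_i P^u_i` (only the linear term
`−P^u_iθ_i` sees the shift). [cite: ShinZavala2020, eq. (10)] -/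
theorem H_add_constMode (x : State n) (c : ℝ) :
    M.H (x + ((fun _ => c, 0, 0) : State n)) = M.H x - c * ∑ i, M.Pu i := by
  obtain ⟨θ, ω, V⟩ := x
  have hθ : (θ + fun _ => c) = fun i => θ i + c := rfl
  simp only [H, Prod.mk_add_mk, add_zero, hθ, add_sub_add_right_eq_sub]
  have hterm : ∀ i, M.τP i / (2 * M.kP i) * ω i ^ 2 + V i / M.kQ i - M.Qu i * Real.log (V i)
        - M.Pu i * (θ i + c)
      = (M.τP i / (2 * M.kP i) * ω i ^ 2 + V i / M.kQ i - M.Qu i * Real.log (V i) - M.Pu i * θ i)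
        - c * M.Pu i := fun i => by ring
  simp only [hterm, Finset.sum_sub_distrib, ← Finset.mul_sum]
  ring

/-- At an equilibrium `Σ_i P^u_i = Σ_i P_i = 0`, so `H` is rotation invariant there:
`H(x* + (c𝟙, 0, 0)) = H(x*)`. [cite: ShinZavala2020, eqs. (9)–(10); SchifferEtAl2014, §5] -/
theorem H_add_constMode_of_equilibrium (hB : ∀ i j, M.B i j = M.B j i) (hkP : ∀ i, M.kP i ≠ 0)
    (hτP : ∀ i, M.τP i ≠ 0) (hτQ : ∀ i, M.τQ i ≠ 0) {xs : State n} (heq : M.field xs = 0) (c : ℝ) :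
    M.H (xs + ((fun _ => c, 0, 0) : State n)) = M.H xs := by
  have hP := ((M.field_eq_zero_iff_steady xs hkP hτP hτQ).1 heq).2.1
  have hsum : ∑ i, M.Pu i = 0 := by
    rw [← M.sum_P_eq_zero hB xs.1 xs.2.2]
    exact Finset.sum_congr rfl fun i _ => (hP i).symm
  rw [M.H_add_constMode, hsum, mul_zero, sub_zero]

/-- `H` is continuous at every state with nonzero voltage amplitudes. [cite: ShinZavala2020, §III-B («H(·,u) is twice continuously differentiable» on `V > 0`)] -/
theorem continuousAt_H (y : State n) (hy : ∀ i, y.2.2 i ≠ 0) : ContinuousAt M.H y := by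
  have hθ : ∀ k, Continuous fun x : State n => x.1 k := fun k =>
    (continuous_apply k).comp continuous_fst
  have hω : ∀ k, Continuous fun x : State n => x.2.1 k := fun k =>
    (continuous_apply k).comp (continuous_fst.comp continuous_snd)
  have hV : ∀ k, Continuous fun x : State n => x.2.2 k := fun k =>
    (continuous_apply k).comp (continuous_snd.comp continuous_snd)
  have h1 : ContinuousAt (fun x : State n => ∑ i, (M.τP i / (2 * M.kP i) * x.2.1 i ^ 2
      + x.2.2 i / M.kQ i - M.Qu i * Real.log (x.2.2 i) - M.Pu i * x.1 i)) y := by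
    refine tendsto_finsetSum _ fun i _ => ?_
    have hlog : ContinuousAt (fun x : State n => Real.log (x.2.2 i)) y :=
      ((hV i).continuousAt).log (hy i)
    exact ((((continuous_const.mul ((hω i).pow 2)).continuousAt).add
      (((hV i).div_const _).continuousAt)).sub (continuousAt_const.mul hlog)).sub
      ((continuous_const.mul (hθ i)).continuousAt)
  have h2 : Continuous fun x : State n =>
      1 / 2 * ∑ i, ∑ j, M.B i j * x.2.2 i * x.2.2 j * cos (x.1 i - x.1 j) :=
    continuous_const.mul (continuous_finsetSum _ fun i _ => continuous_finsetSum _ fun j _ =>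
      ((continuous_const.mul (hV i)).mul (hV j)).mul (Real.continuous_cos.comp ((hθ i).sub (hθ j))))
  exact h1.sub h2.continuousAt

/-- The derivative of `H` along a straight line `ε ↦ x + εv` at a point with positive voltages is
the pairing of the gradient (11) with `v`. [cite: ShinZavala2020, eqs. (11a)–(11c)] -/
theorem hasDerivAt_H_line (hB : ∀ i j, M.B i j = M.B j i) (x v : State n) {ε : ℝ}
    (hpos : ∀ i, 0 < (x + ε • v).2.2 i) :
    HasDerivAt (fun e : ℝ => M.H (x + e • v)) (pair (M.gradH (x + ε • v)) v) ε := by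
  have hline : ∀ (a b : ℝ), HasDerivAt (fun e : ℝ => a + e * b) b ε := fun a b => by
    simpa using ((hasDerivAt_id ε).mul_const b).const_add a
  have h := M.hasDerivWithinAt_H hB (γ := fun e : ℝ => x + e • v) (s := Set.univ) (t := ε)
    (θ' := v.1) (ω' := v.2.1) (V' := v.2.2)
    (fun i => (hline (x.1 i) (v.1 i)).hasDerivWithinAt)
    (fun i => (hline (x.2.1 i) (v.2.1 i)).hasDerivWithinAt)
    (fun i => (hline (x.2.2 i) (v.2.2 i)).hasDerivWithinAt) hpos
  rw [hasDerivWithinAt_univ] at h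
  rw [pair_eq_sum]
  exact h

/-- **A negative curvature direction of `H` at the equilibrium gives lower energy arbitrarily close
by**: if `vᵀ∇ₓₓH(x*)v < 0` then `H(x* + εv) < H(x*)` with `V(x* + εv) > 0` for all small `ε > 0`
(second-order Taylor along the line: the slope `dH(x* + εv)/dε` vanishes at `ε = 0`, `∇H(x*) = 0`,
and has derivative `vᵀ∇ₓₓH(x*)v < 0` there). [cite: ShinZavala2020, Prop. 1 («local strict minimum … with ∇ₓₓH(x*,u) > 0»), eqs. (11), (15)] -/
theorem H_lt_of_negCurvature (hB : ∀ i j, M.B i j = M.B j i) (hkP : ∀ i, M.kP i ≠ 0)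
    (hτP : ∀ i, M.τP i ≠ 0) (hkQ : ∀ i, M.kQ i ≠ 0) (hτQ : ∀ i, M.τQ i ≠ 0) {xs : State n}
    (heq : M.field xs = 0) (hV : ∀ i, 0 < xs.2.2 i) {v : State n}
    (hv : pair v (M.hessCLM xs v) < 0) :
    ∃ ε₀ > 0, ∀ ε ∈ Set.Ioo (0 : ℝ) ε₀,
      (∀ e ∈ Set.Icc (0 : ℝ) ε, ∀ i, 0 < (xs + e • v).2.2 i) ∧ M.H (xs + ε • v) < M.H xs := by
  have hV0 : ∀ i, xs.2.2 i ≠ 0 := fun i => (hV i).ne'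
  -- positivity of the voltages on a neighbourhood of `ε = 0`
  have hposev : ∀ i, ∀ᶠ e in 𝓝 (0 : ℝ), 0 < (xs + e • v).2.2 i := by
    intro i
    have hc : Continuous fun e : ℝ => (xs + e • v).2.2 i :=
      (continuous_apply i).comp (continuous_snd.comp (continuous_snd.comp
        (continuous_const.add (continuous_id.smul continuous_const))))
    have h0 : 0 < (xs + (0 : ℝ) • v).2.2 i := by simpa using hV i
    exact hc.continuousAt.eventually (lt_mem_nhds h0)
  obtain ⟨δ, hδ, hδpos⟩ := Metric.eventually_nhds_iff.1 (Filter.eventually_all.2 hposev)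
  -- the slope `φ(ε) = dH(x* + εv)/dε = ⟨∇H(x* + εv), v⟩`, with `φ(0) = 0` and `φ'(0) = vᵀQv < 0`
  set φ : ℝ → ℝ := fun e => pair (M.gradH (xs + e • v)) v with hφ
  have hφ0 : φ 0 = 0 := by
    have hcrit := (M.field_eq_zero_iff xs hkP hτP hkQ hτQ hV0).1 heq
    have hg : M.gradH xs = 0 := by
      refine Prod.ext (funext fun i => (hcrit i).1) (Prod.ext (funext fun i => (hcrit i).2.1)
        (funext fun i => (hcrit i).2.2))
    simp [hφ, hg, pair]
  -- `φ` is differentiable at `0` with derivative `pair (Q v) v`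
  set Lv : State n →L[ℝ] ℝ :=
    ∑ k : Idx n, flat v k • ((ContinuousLinearMap.proj k).comp (flatL n)) with hLv
  have hLv_apply : ∀ w : State n, Lv w = pair w v := by
    intro w
    rw [pair_comm]
    simp only [hLv, FunLike.coe_sum, Finset.sum_apply, FunLike.coe_smul,
      Pi.smul_apply, ContinuousLinearMap.coe_comp, Function.comp_apply, flatL_apply,
      ContinuousLinearMap.proj_apply, smul_eq_mul, pair, dotProduct]
  have hline0 : HasDerivAt (fun e : ℝ => xs + e • v) v 0 := by
    simpa using ((hasDerivAt_id (0 : ℝ)).smul_const v).const_add xs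
  have hgrad : HasDerivAt (fun e : ℝ => M.gradH (xs + e • v)) (M.hessCLM xs v) 0 := by
    have hG : HasFDerivAt M.gradH (M.hessCLM xs) (xs + (0 : ℝ) • v) := by
      simpa using M.hasFDerivAt_gradH xs hV0
    exact hG.comp_hasDerivAt (0 : ℝ) hline0
  have hφ' : HasDerivAt φ (pair v (M.hessCLM xs v)) 0 := by
    have h := Lv.hasFDerivAt.comp_hasDerivAt (0 : ℝ) hgrad
    have e1 : (fun e : ℝ => Lv (M.gradH (xs + e • v))) = φ := funext fun e => hLv_apply _
    rw [← e1]
    rw [hLv_apply, pair_comm] at h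
    exact h
  -- hence `φ(ε) < 0` for small `ε > 0`
  have hslope : ∀ᶠ e in 𝓝[≠] (0 : ℝ), slope φ 0 e < 0 :=
    (hasDerivAt_iff_tendsto_slope.1 hφ').eventually (Iio_mem_nhds hv)
  have hneg : ∀ᶠ e in 𝓝[>] (0 : ℝ), φ e < 0 := by
    have h1 : ∀ᶠ e in 𝓝[>] (0 : ℝ), slope φ 0 e < 0 :=
      hslope.filter_mono (nhdsWithin_mono _ fun e he => ne_of_gt he)
    filter_upwards [h1, self_mem_nhdsWithin] with e he he0
    rw [slope_def_field, hφ0, sub_zero, sub_zero] at he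
    have := mul_neg_of_neg_of_pos he (he0 : (0 : ℝ) < e)
    rwa [div_mul_cancel₀ _ (ne_of_gt he0)] at this
  obtain ⟨u, hu, huφ⟩ := mem_nhdsGT_iff_exists_Ioo_subset.1 hneg
  refine ⟨min u δ, lt_min hu hδ, fun ε hε => ?_⟩
  have hεu : ε < u := lt_of_lt_of_le hε.2 (min_le_left _ _)
  have hεδ : ε < δ := lt_of_lt_of_le hε.2 (min_le_right _ _)
  have hposseg : ∀ e ∈ Set.Icc (0 : ℝ) ε, ∀ i, 0 < (xs + e • v).2.2 i := by
    intro e he i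
    refine hδpos ?_ i
    rw [dist_zero_right, Real.norm_eq_abs, abs_of_nonneg he.1]
    exact lt_of_le_of_lt he.2 hεδ
  refine ⟨hposseg, ?_⟩
  -- mean value theorem on `[0, ε]`
  have hderiv : ∀ e ∈ Set.Icc (0 : ℝ) ε, HasDerivAt (fun e : ℝ => M.H (xs + e • v)) (φ e) e :=
    fun e he => M.hasDerivAt_H_line hB xs v (hposseg e he)
  have hcont : ContinuousOn (fun e : ℝ => M.H (xs + e • v)) (Set.Icc 0 ε) :=
    fun e he => (hderiv e he).continuousAt.continuousWithinAt
  obtain ⟨ξ, hξ, hξeq⟩ := exists_hasDerivAt_eq_slope (fun e : ℝ => M.H (xs + e • v)) φ hε.1 hcont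
    (fun e he => hderiv e ⟨he.1.le, he.2.le⟩)
  have hξneg : φ ξ < 0 := huφ ⟨hξ.1, hξ.2.trans hεu⟩
  rw [hξeq, sub_zero, zero_smul, add_zero] at hξneg
  have := (div_neg_iff.1 hξneg).resolve_left (fun h => absurd h.2 (not_lt.2 hε.1.le))
  linarith [this.1]

/-- **The Hessian test is sharp (negative direction ⇒ no convergence).**  `B` symmetric, positive
gains and time constants, `x*` an equilibrium of (9) with `V* > 0`, and a direction `v` with
`vᵀ∇ₓₓH(x*)v < 0`.  Then for every `ρ > 0` there is an initial state `x₀` with `‖x₀ − x*‖ < ρ`,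
positive voltages and `H(x₀) < H(x*)`, such that NO solution of (9) from `x₀` that keeps positive
voltage amplitudes (the model's domain `D = ℝ^{2n−1} × ℝⁿ_{>0}`) converges to any rotation
`(θ* + c𝟙, ω̃*, V*)` of the equilibrium: along solutions `H` is non-increasing (the dissipation
inequality (13), companion `H_antitoneOn`), `H(x(t)) ≤ H(x₀) < H(x*) = H(x* + (c𝟙, 0, 0))`, while
convergence would force `H(x(t)) → H(x*)`.  (The converse companion of
`expStable_modRotation_of_hessian`; the degenerate case — `∇ₓₓH(x*) ⪰ 0` with a kernel larger than
the rotation — is not decided by the Hessian.)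
[cite: ShinZavala2020, §III-B eq. (13) («the Hamiltonian can be used as a Lyapunov function»), §III-C Prop. 1 and Remark 5 («if such conditions are not satisfied, there is no guarantee for stability»); Khalil2002, §4.1 (Chetaev's theorem 4.3, instability from a Lyapunov-like function)] -/
theorem not_tendsto_of_negCurvature (hB : ∀ i j, M.B i j = M.B j i) (hkP : ∀ i, 0 < M.kP i)
    (hτP : ∀ i, 0 < M.τP i) (hkQ : ∀ i, 0 < M.kQ i) (hτQ : ∀ i, 0 < M.τQ i) {xs : State n}
    (heq : M.field xs = 0) (hV : ∀ i, 0 < xs.2.2 i) {v : State n}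
    (hv : pair v (M.hessCLM xs v) < 0) {ρ : ℝ} (hρ : 0 < ρ) :
    ∃ x₀ : State n, ‖x₀ - xs‖ < ρ ∧ (∀ i, 0 < x₀.2.2 i) ∧ M.H x₀ < M.H xs ∧
      ∀ X : ℝ → State n, X 0 = x₀ → (∀ T : ℝ, M.IsSolutionOn X (Icc 0 T)) →
        (∀ t : ℝ, 0 ≤ t → ∀ i, 0 < (X t).2.2 i) →
        ∀ c : ℝ, ¬ Tendsto X atTop (𝓝 (xs + ((fun _ => c, 0, 0) : State n))) := by
  have hkP0 : ∀ i, M.kP i ≠ 0 := fun i => (hkP i).ne'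
  have hτP0 : ∀ i, M.τP i ≠ 0 := fun i => (hτP i).ne'
  have hkQ0 : ∀ i, M.kQ i ≠ 0 := fun i => (hkQ i).ne'
  have hτQ0 : ∀ i, M.τQ i ≠ 0 := fun i => (hτQ i).ne'
  obtain ⟨ε₀, hε₀, hsmall⟩ := M.H_lt_of_negCurvature hB hkP0 hτP0 hkQ0 hτQ0 heq hV hv
  -- a small `ε` with `ε‖v‖ < ρ`
  set ε : ℝ := min (ε₀ / 2) (ρ / (2 * (‖v‖ + 1))) with hεdef
  have hεpos : 0 < ε := lt_min (by positivity) (by positivity)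
  have hεε₀ : ε < ε₀ := lt_of_le_of_lt (min_le_left _ _) (by linarith)
  obtain ⟨hposseg, hHlt⟩ := hsmall ε ⟨hεpos, hεε₀⟩
  refine ⟨xs + ε • v, ?_, hposseg ε ⟨hεpos.le, le_rfl⟩, hHlt, ?_⟩
  · rw [add_sub_cancel_left, norm_smul, Real.norm_eq_abs, abs_of_pos hεpos]
    have h1 : ε ≤ ρ / (2 * (‖v‖ + 1)) := min_le_right _ _
    have h2 : ε * ‖v‖ ≤ ρ / (2 * (‖v‖ + 1)) * (‖v‖ + 1) :=
      mul_le_mul h1 (by linarith) (norm_nonneg _) (by positivity)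
    have h3 : ρ / (2 * (‖v‖ + 1)) * (‖v‖ + 1) = ρ / 2 := by
      rw [← div_div, div_mul_cancel₀ _ (by positivity)]
    linarith
  intro X hX0 hX hXpos c hconv
  -- `H(X t) ≤ H(x₀)` for all `t ≥ 0`
  have hmono : ∀ t, 0 ≤ t → M.H (X t) ≤ M.H (xs + ε • v) := by
    intro t ht
    rw [← hX0]
    exact M.H_antitoneOn hB hkP hτP hkQ hτQ (hX t) (fun s hs => hXpos s hs.1)
      ⟨le_rfl, ht⟩ ⟨ht, le_rfl⟩ ht
  -- but `H(X t) → H(x* + (c𝟙,0,0)) = H(x*)`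
  have hlim : Tendsto (fun t => M.H (X t)) atTop (𝓝 (M.H xs)) := by
    have hc : ContinuousAt M.H (xs + ((fun _ => c, 0, 0) : State n)) := by
      refine M.continuousAt_H _ fun i => ?_
      have : (xs + ((fun _ => c, 0, 0) : State n)).2.2 i = xs.2.2 i := by simp
      rw [this]
      exact (hV i).ne'
    have h := hc.tendsto.comp hconv
    rwa [M.H_add_constMode_of_equilibrium hB hkP0 hτP0 hτQ0 heq c] at h
  have hle : M.H xs ≤ M.H (xs + ε • v) :=
    le_of_tendsto hlim (Filter.eventually_atTop.2 ⟨0, fun t ht => hmono t ht⟩)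
  linarith

end NegativeCurvature

/-! ## §10 Uniqueness of solutions of (9) (append): a `C¹` field has unique solutions -/

section Uniqueness

open Metric

/-- **Solutions of (9) are unique**: two solutions on `[0, T]` with the same initial state coincide
(the field is `C¹`, `contDiff_field`, hence Lipschitz on a compact ball containing both compact
trajectories — tree `exists_lipschitzOnWith_of_isCompact` — and Grönwall, tree
`dist_le_of_solutions`).  With `exists_solution_expStable_modRotation` this makes the model (9)
well posed near `x*`: THE solution from `x₀` converges exponentially to a rotation of `x*`.
[cite: ShinZavala2020, eq. (9); RoucheHabetsLaloy1977, Ch. I Thm 6.2 (a); Khalil2002, Theorem 3.1 (local existence and uniqueness for locally Lipschitz fields)] -/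
theorem solution_unique (X Y : ℝ → State n) (T : ℝ) (hX : M.IsSolutionOn X (Icc 0 T))
    (hY : M.IsSolutionOn Y (Icc 0 T)) (h0 : X 0 = Y 0) : ∀ t ∈ Icc (0 : ℝ) T, X t = Y t := by
  intro t ht
  have hXc : ContinuousOn X (Icc 0 T) := fun s hs => (hX s hs).continuousWithinAt
  have hYc : ContinuousOn Y (Icc 0 T) := fun s hs => (hY s hs).continuousWithinAt
  obtain ⟨RX, hRX⟩ := isCompact_Icc.exists_bound_of_continuousOn hXc
  obtain ⟨RY, hRY⟩ := isCompact_Icc.exists_bound_of_continuousOn hYc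
  set K : Set (State n) := closedBall (0 : State n) (max RX RY) with hK
  obtain ⟨Lip, hLip⟩ := Literature.Analysis.ODE.exists_lipschitzOnWith_of_isCompact isOpen_univ
    M.contDiff_field.contDiffOn (isCompact_closedBall _ _) (Set.subset_univ K)
  have hXK : ∀ s ∈ Icc (0 : ℝ) T, X s ∈ K := fun s hs =>
    mem_closedBall.2 (by rw [dist_zero_right]; exact (hRX s hs).trans (le_max_left _ _))
  have hYK : ∀ s ∈ Icc (0 : ℝ) T, Y s ∈ K := fun s hs =>
    mem_closedBall.2 (by rw [dist_zero_right]; exact (hRY s hs).trans (le_max_right _ _))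
  have hd := Literature.Analysis.ODE.dist_le_of_solutions hLip hX hY hXK hYK t ht
  rw [h0, dist_self, zero_mul] at hd
  exact dist_le_zero.1 hd

end Uniqueness

/-! ## §11 The rotation selected by the initial state: `⟨ℓ, x⟩` with `ℓ = (1/k_P, τ_P/k_P, 0)` is a
first integral, so the limit rotation is `c = ⟨ℓ, x₀ − x*⟩ / Σ_i k_Pi⁻¹` (append) -/

section FirstIntegral

open _root_.Filter Metric
open scoped _root_.Topology

/-- `⟨ℓ, f(x)⟩ = Σ_i P^u_i` for `ℓ = (1/k_P, τ_P/k_P, 0)`: along (9),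
`d/dt Σ_i (θ_i/k_Pi + τ_Piω̃_i/k_Pi) = −Σ_i (P_i − P^u_i) = Σ_i P^u_i` (lossless, `Σ_i P_i = 0`).
[cite: ShinZavala2020, eq. (9); SchifferEtAl2014, §5 (synchronised frequency from `Σ_i P_i`)] -/
theorem pair_leftMode_field (hB : ∀ i j, M.B i j = M.B j i) (hkP : ∀ i, M.kP i ≠ 0)
    (hτP : ∀ i, M.τP i ≠ 0) (x : State n) : pair M.leftMode (M.field x) = ∑ i, M.Pu i := by
  have hterm : ∀ i, M.leftMode.1 i * (M.field x).1 i + M.leftMode.2.1 i * (M.field x).2.1 i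
      + M.leftMode.2.2 i * (M.field x).2.2 i = M.Pu i - M.P x.1 x.2.2 i := by
    intro i
    simp only [leftMode, field, Pi.zero_apply, zero_mul, add_zero]
    field_simp [hkP i, hτP i]
    ring
  rw [pair_eq_sum, Finset.sum_congr rfl fun i _ => hterm i, Finset.sum_sub_distrib,
    M.sum_P_eq_zero hB, sub_zero]

/-- At parameters admitting an equilibrium, `Σ_i P^u_i = 0`, hence **`⟨ℓ, x(t)⟩` is conserved along
every solution of (9)**. [cite: ShinZavala2020, eq. (9); SchifferEtAl2014, §5] -/
theorem pair_leftMode_eq_of_solution (hB : ∀ i j, M.B i j = M.B j i) (hkP : ∀ i, M.kP i ≠ 0)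
    (hτP : ∀ i, M.τP i ≠ 0) (hτQ : ∀ i, M.τQ i ≠ 0) {xs : State n} (heq : M.field xs = 0)
    {X : ℝ → State n} {T : ℝ} (hX : M.IsSolutionOn X (Icc 0 T)) :
    ∀ t ∈ Icc (0 : ℝ) T, pair M.leftMode (X t) = pair M.leftMode (X 0) := by
  have hP := ((M.field_eq_zero_iff_steady xs hkP hτP hτQ).1 heq).2.1
  have hsum : ∑ i, M.Pu i = 0 := by
    rw [← M.sum_P_eq_zero hB xs.1 xs.2.2]
    exact Finset.sum_congr rfl fun i _ => (hP i).symm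
  set L : State n →L[ℝ] ℝ :=
    ∑ k : Idx n, flat M.leftMode k • ((ContinuousLinearMap.proj k).comp (flatL n)) with hL
  have hL_apply : ∀ w : State n, L w = pair M.leftMode w := by
    intro w
    simp only [hL, FunLike.coe_sum, Finset.sum_apply, FunLike.coe_smul,
      Pi.smul_apply, ContinuousLinearMap.coe_comp, Function.comp_apply, flatL_apply,
      ContinuousLinearMap.proj_apply, smul_eq_mul, pair, dotProduct]
  have hderiv : ∀ t ∈ Icc (0 : ℝ) T,
      HasDerivWithinAt (fun s => pair M.leftMode (X s)) 0 (Icc 0 T) t := by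
    intro t ht
    have h := L.hasFDerivAt.comp_hasDerivWithinAt t (hX t ht)
    have e1 : (⇑L ∘ X) = fun s => pair M.leftMode (X s) := funext fun s => hL_apply _
    rw [hL_apply, M.pair_leftMode_field hB hkP hτP, hsum] at h
    rwa [e1] at h
  have hcont : ContinuousOn (fun s => pair M.leftMode (X s)) (Icc 0 T) :=
    fun t ht => (hderiv t ht).continuousWithinAt
  refine constant_of_has_deriv_right_zero hcont fun t ht => ?_
  refine (hderiv t ⟨ht.1, ht.2.le⟩).mono_of_mem_nhdsWithin ?_
  exact mem_of_superset (Icc_mem_nhdsGE ht.2) (Icc_subset_Icc ht.1 le_rfl)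

/-- `⟨ℓ, (c𝟙, 0, 0)⟩ = c Σ_i k_Pi⁻¹`. [folklore] -/
private theorem pair_leftMode_constMode (c : ℝ) :
    pair M.leftMode ((fun _ => c, 0, 0) : State n) = c * ∑ i, 1 / M.kP i := by
  rw [pair_eq_sum, Finset.mul_sum]
  refine Finset.sum_congr rfl fun i _ => ?_
  simp only [leftMode, Pi.zero_apply, mul_zero, add_zero]
  ring

/-- **The limit rotation is determined by the initial state**: if a solution of (9) on `[0, ∞)`
converges to the rotation `(θ* + c𝟙, ω̃*, V*)` of an equilibrium, then
`c Σ_i k_Pi⁻¹ = ⟨ℓ, x(0) − x*⟩ = Σ_i ((θ_i(0) − θ*_i) + τ_Pi(ω̃_i(0) − ω̃*_i))/k_Pi` (conservation of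
`⟨ℓ, x⟩` and continuity). [cite: SchifferEtAl2014, §5 («up to a uniform shift of all angles»); ShinZavala2020, eq. (9)] -/
theorem rotation_eq_of_tendsto (hB : ∀ i j, M.B i j = M.B j i) (hkP : ∀ i, M.kP i ≠ 0)
    (hτP : ∀ i, M.τP i ≠ 0) (hτQ : ∀ i, M.τQ i ≠ 0) {xs : State n} (heq : M.field xs = 0)
    {X : ℝ → State n} (hX : ∀ T : ℝ, M.IsSolutionOn X (Icc 0 T)) {c : ℝ}
    (hlim : Tendsto X atTop (𝓝 (xs + ((fun _ => c, 0, 0) : State n)))) :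
    c * ∑ i, 1 / M.kP i = pair M.leftMode (X 0 - xs) := by
  have hconst : ∀ t, 0 ≤ t → pair M.leftMode (X t) = pair M.leftMode (X 0) :=
    fun t ht => M.pair_leftMode_eq_of_solution hB hkP hτP hτQ heq (hX t) t ⟨ht, le_rfl⟩
  -- continuity of `w ↦ ⟨ℓ, w⟩`
  have hcont : Continuous fun w : State n => pair M.leftMode w := by
    simp only [pair_eq_sum]
    refine continuous_finsetSum _ fun i _ => ?_
    exact ((continuous_const.mul ((continuous_apply i).comp continuous_fst)).add
      (continuous_const.mul ((continuous_apply i).comp (continuous_fst.comp continuous_snd)))).add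
      (continuous_const.mul ((continuous_apply i).comp (continuous_snd.comp continuous_snd)))
  have h1 : Tendsto (fun t => pair M.leftMode (X t)) atTop
      (𝓝 (pair M.leftMode (xs + ((fun _ => c, 0, 0) : State n)))) :=
    (hcont.tendsto _).comp hlim
  have h2 : Tendsto (fun t => pair M.leftMode (X t)) atTop (𝓝 (pair M.leftMode (X 0))) :=
    tendsto_const_nhds.congr' (Filter.eventually_atTop.2 ⟨0, fun t ht => (hconst t ht).symm⟩)
  have h := tendsto_nhds_unique h1 h2
  have hlin : pair M.leftMode (xs + ((fun _ => c, 0, 0) : State n))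
      = pair M.leftMode xs + c * ∑ i, 1 / M.kP i := by
    rw [← M.pair_leftMode_constMode c]
    simp [pair, dotProduct_add]
  have hlin2 : pair M.leftMode (X 0 - xs) = pair M.leftMode (X 0) - pair M.leftMode xs := by
    simp [pair, dotProduct_sub]
  rw [hlin] at h
  rw [hlin2]
  linarith

/-- **Schiffer et al. Prop. 5.9 / Shin–Zavala Prop. 1 with the LIMIT IDENTIFIED**: under the
hypotheses of `expStable_modRotation_of_hessian`, from every `x₀` with `‖x₀ − x*‖ < ρ` the solution
of (9) (it exists, `exists_solution_expStable_modRotation`, and is unique, `solution_unique`)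
converges exponentially to the rotation `(θ* + c𝟙, ω̃*, V*)` with
`c = ⟨ℓ, x₀ − x*⟩ / Σ_i k_Pi⁻¹`, `ℓ = (1/k_P, τ_P/k_P, 0)` — the synchronous state selected by the
conserved quantity `Σ_i (θ_i + τ_Piω̃_i)/k_Pi`.
[cite: SchifferEtAl2014, §5.3 Proposition 5.9 and §5 («converge to the synchronized motion (17) (up to a uniform shift of all angles)»); ShinZavala2020, §III-C Proposition 1; Khalil2002, Theorem 4.7] -/
theorem exists_solution_expStable_rotation_eq (hB : ∀ i j, M.B i j = M.B j i)
    (hkP : ∀ i, 0 < M.kP i) (hτP : ∀ i, 0 < M.τP i) (hkQ : ∀ i, 0 < M.kQ i) (hτQ : ∀ i, 0 < M.τQ i)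
    {xs : State n} (heq : M.field xs = 0) (hV : ∀ i, 0 < xs.2.2 i)
    (hpsd : ∀ v : State n, 0 ≤ pair v (M.hessCLM xs v))
    (hker : ∀ v : State n, pair v (M.hessCLM xs v) = 0 → ∃ a : ℝ, v = (fun _ => a, 0, 0)) :
    ∃ ρ > 0, ∃ k > 0, ∃ lam > 0, ∀ x₀ : State n, ‖x₀ - xs‖ < ρ →
      ∃ X : ℝ → State n, X 0 = x₀ ∧ (∀ T : ℝ, M.IsSolutionOn X (Icc 0 T)) ∧
        ∀ t : ℝ, 0 ≤ t →
          ‖X t - (xs + ((fun _ => pair M.leftMode (x₀ - xs) / ∑ i, 1 / M.kP i, 0, 0) : State n))‖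
            ≤ k * ‖x₀ - xs‖ * Real.exp (-lam * t) := by
  have hkP0 : ∀ i, M.kP i ≠ 0 := fun i => (hkP i).ne'
  have hτP0 : ∀ i, M.τP i ≠ 0 := fun i => (hτP i).ne'
  have hτQ0 : ∀ i, M.τQ i ≠ 0 := fun i => (hτQ i).ne'
  obtain ⟨ρ, hρ, k, hk, lam, hlam, H⟩ :=
    M.exists_solution_expStable_modRotation hB hkP hτP hkQ hτQ heq hV hpsd hker
  refine ⟨ρ, hρ, k, hk, lam, hlam, fun x₀ hx₀ => ?_⟩
  obtain ⟨X, hX0, hX, c, hc⟩ := H x₀ hx₀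
  rcases Nat.eq_zero_or_pos n with hn | hn
  · subst hn
    refine ⟨X, hX0, hX, fun t ht => ?_⟩
    have h0 : X t - (xs + ((fun _ => pair M.leftMode (x₀ - xs) / ∑ i, 1 / M.kP i, 0, 0) :
        State 0)) = 0 := Subsingleton.elim _ _
    rw [h0, norm_zero]
    positivity
  haveI : Nonempty (Fin n) := ⟨⟨0, hn⟩⟩
  -- the solution converges to `xs + (c𝟙, 0, 0)`, so `c` is the conserved-quantity value
  have hlim : Tendsto X atTop (𝓝 (xs + ((fun _ => c, 0, 0) : State n))) := by
    rw [tendsto_iff_norm_sub_tendsto_zero]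
    have hexp : Tendsto (fun t : ℝ => k * ‖x₀ - xs‖ * Real.exp (-lam * t)) atTop (𝓝 0) := by
      have h1 : Tendsto (fun t : ℝ => Real.exp (-lam * t)) atTop (𝓝 0) := by
        have := Real.tendsto_exp_neg_atTop_nhds_zero.comp (tendsto_id.const_mul_atTop hlam)
        refine this.congr fun t => ?_
        simp [neg_mul]
      simpa using h1.const_mul (k * ‖x₀ - xs‖)
    refine squeeze_zero_norm' ?_ hexp
    filter_upwards [Filter.eventually_ge_atTop (0 : ℝ)] with t ht
    rw [norm_norm]
    exact hc t ht
  have hceq := M.rotation_eq_of_tendsto hB hkP0 hτP0 hτQ0 heq hX hlim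
  have hS : 0 < ∑ i, 1 / M.kP i :=
    Finset.sum_pos (fun i _ => one_div_pos.2 (hkP i)) Finset.univ_nonempty
  have hcval : c = pair M.leftMode (x₀ - xs) / ∑ i, 1 / M.kP i := by
    rw [eq_div_iff hS.ne', hceq, hX0]
  refine ⟨X, hX0, hX, fun t ht => ?_⟩
  rw [← hcval]
  exact hc t ht

end FirstIntegral

/-! ## §12 The decoupled (constant-voltage) model (18) IS the swing equation with `M = τ_P/k_P`,
`D = 1/k_P`, `C_ij = Ṽ_iṼ_jB_ij`: local exponential stability modulo rotation of a phase-cohesive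
equilibrium, BY NAME from the tree's lossless multimachine theorems (append) -/

section Decoupled

/-- **The decoupled model (18)** (voltage magnitudes frozen at `Ṽ`; reactive-power dynamics dropped —
the «decoupling approximation» of Dörfler et al.), in full angle coordinates:
`θ̇_i = ω̃_i`, `τ_Pi ω̃̇_i = −ω̃_i − k_Pi(P_i(θ, Ṽ) − P^u_i)`.
[cite: ShinZavala2020, §IV-B eqs. (18a)–(18c)] -/
def decField (Vt : Fin n → ℝ) (y : (Fin n → ℝ) × (Fin n → ℝ)) : (Fin n → ℝ) × (Fin n → ℝ) :=
  (y.2, fun i => (-y.2 i - M.kP i * (M.P y.1 Vt i - M.Pu i)) / M.τP i)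

/-- The decoupled model as a lossless multimachine (swing-equation) system WITHOUT infinite bus:
inertias `M_i = τ_Pi/k_Pi`, dampings `D_i = 1/k_Pi`, powers `P^u_i`, couplings `C_ij = Ṽ_iṼ_jB_ij`.
[cite: ShinZavala2020, §IV-B (18) («A similar derivation of the Hamiltonian can be found in [20] (the authors call this an energy function)»)] -/
def decSystem (Vt : Fin n → ℝ) : ClassicalModel.LosslessSystem n 0 where
  M := fun i => M.τP i / M.kP i
  D := fun i => 1 / M.kP i
  P := M.Pu
  C := fun i j => Vt i * Vt j * M.B i j
  K := fun _ b => b.elim0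
  β := fun b => b.elim0

/-- **(18) = the swing equations** of `decSystem` on the phase space `(θ, ω̃)` (`k_P, τ_P ≠ 0`).
[cite: ShinZavala2020, §IV-B (18)] -/
theorem decField_eq_field (hkP : ∀ i, M.kP i ≠ 0) (hτP : ∀ i, M.τP i ≠ 0) (Vt : Fin n → ℝ) :
    M.decField Vt = (M.decSystem Vt).field := by
  funext y
  refine Prod.ext rfl (funext fun i => ?_)
  simp only [decField, ClassicalModel.LosslessSystem.field, decSystem, ClassicalModel.LosslessSystem.flow,
    P, Finset.univ_eq_empty, Finset.sum_empty, add_zero]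
  field_simp [hkP i, hτP i]
  ring

/-- **Stability of the decoupled model (18), modulo the rotation, from network data** («Proposition 1
can be applied … ∇H̃ is PD if `θ ∈ Θ_G(π/2)`»): `B` symmetric with nonnegative line susceptances and a
connected coupling graph, `k_P, τ_P > 0`, `Ṽ > 0`, an equilibrium `θe` of (18)
(`P_i(θe, Ṽ) = P^u_i`) that is strictly phase cohesive across the lines (`cos(θe_i − θe_j) > 0`
where `B_ij > 0`).  Then there are `ρ, k, λ > 0` such that every solution `(θ, ω̃)` of (18) on `[0, T]`
with `‖(θ, ω̃)(0) − (θe, 0)‖ < ρ` satisfies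
`‖(θ, ω̃)(t) − (θe + c𝟙, 0)‖ ≤ k‖(θ, ω̃)(0) − (θe + c𝟙, 0)‖e^{−λt}` with the rotation
`c = Σ_i(D_i(θ_i(0) − θe_i) + M_iω̃_i(0))/Σ_iD_i`, `D_i = 1/k_Pi`, `M_i = τ_Pi/k_Pi` — BY NAME the tree's
`ClassicalModel.LosslessSystem.expStable_modRotation_of_normalOperation` for `decSystem`.
[cite: ShinZavala2020, §IV-B («the minimizer of H̃(·,ũ) is a stable equilibrium of (18) … ∇H̃ is PD if θ ∈ Θ_G(π/2)»); SchifferEtAl2014, §5.2; Khalil2002, Theorem 4.7] -/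
theorem decoupled_expStable_modRotation (hB : ∀ i j, M.B i j = M.B j i)
    (hBnn : ∀ i j, i ≠ j → 0 ≤ M.B i j) (hconn : ClassicalModel.CouplingConnected M.B)
    (hkP : ∀ i, 0 < M.kP i) (hτP : ∀ i, 0 < M.τP i) {Vt : Fin n → ℝ} (hVt : ∀ i, 0 < Vt i)
    {θe : Fin n → ℝ} (he : ∀ i, M.P θe Vt i = M.Pu i)
    (hcoh : ∀ i j, i ≠ j → 0 < M.B i j → 0 < Real.cos (θe i - θe j)) (i₀ : Fin n) :
    ∃ ρ > 0, ∃ k > 0, ∃ lam > 0, ∀ (X : ℝ → (Fin n → ℝ) × (Fin n → ℝ)) (T : ℝ),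
      (∀ t ∈ Icc 0 T, HasDerivWithinAt X (M.decField Vt (X t)) (Icc 0 T) t) →
      ‖X 0 - (θe, 0)‖ < ρ →
      ∀ t ∈ Icc 0 T,
        ‖X t - ((fun i => θe i + (M.decSystem Vt).momWeights ⬝ᵥ
            (ClassicalModel.LosslessSystem.flat (X 0) - ClassicalModel.LosslessSystem.flat (θe, 0))
              / ∑ i, (M.decSystem Vt).D i), 0)‖
          ≤ k * ‖X 0 - ((fun i => θe i + (M.decSystem Vt).momWeights ⬝ᵥ
            (ClassicalModel.LosslessSystem.flat (X 0) - ClassicalModel.LosslessSystem.flat (θe, 0))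
              / ∑ i, (M.decSystem Vt).D i), 0)‖ * Real.exp (-lam * t) := by
  set S := M.decSystem Vt with hS
  have hC : ∀ i j, S.C i j = S.C j i := fun i j => by
    show Vt i * Vt j * M.B i j = Vt j * Vt i * M.B j i
    rw [hB i j]; ring
  have hCpos_iff : ∀ i j, 0 < S.C i j ↔ 0 < M.B i j := fun i j => by
    show 0 < Vt i * Vt j * M.B i j ↔ 0 < M.B i j
    exact ⟨fun h => pos_of_mul_pos_right h (mul_pos (hVt i) (hVt j)).le,
      fun h => mul_pos (mul_pos (hVt i) (hVt j)) h⟩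
  have hC0 : ∀ i j, i ≠ j → 0 ≤ S.C i j := fun i j hij =>
    mul_nonneg (mul_pos (hVt i) (hVt j)).le (hBnn i j hij)
  have hconn' : ClassicalModel.CouplingConnected S.C := by
    intro A hA hAc
    obtain ⟨i, hi, j, hj, hij⟩ := hconn A hA hAc
    exact ⟨i, hi, j, hj, (hCpos_iff i j).2 hij⟩
  have hM : ∀ i, 0 < S.M i := fun i => div_pos (hτP i) (hkP i)
  have hD : ∀ i, 0 < S.D i := fun i => one_div_pos.2 (hkP i)
  have heq : S.IsEquilibrium θe := by
    intro i
    show M.Pu i = S.flow θe i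
    rw [← he i]
    simp only [ClassicalModel.LosslessSystem.flow, P, hS, decSystem, Finset.univ_eq_empty,
      Finset.sum_empty, add_zero]
  have hcoh' : ∀ i j, i ≠ j → 0 < S.C i j → 0 < Real.cos (θe i - θe j) :=
    fun i j hij hc => hcoh i j hij ((hCpos_iff i j).1 hc)
  obtain ⟨ρ, hρ, k, hk, lam, hlam, H⟩ :=
    S.expStable_modRotation_of_normalOperation hC hC0 hconn' hM hD heq hcoh' i₀
  refine ⟨ρ, hρ, k, hk, lam, hlam, fun X T hX hX0 => H X T (fun t ht => ?_) hX0⟩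
  have := hX t ht
  rwa [M.decField_eq_field (fun i => (hkP i).ne') (fun i => (hτP i).ne')] at this

end Decoupled

/-! ## §13 `D(u) + T(x) ≻ 0` from data (Shin–Zavala, proof of Prop. 2): the `V`-block of the
Hessian is positive definite at EVERY state for a network without shunt susceptance and positive
reactive inputs `Q^u_i > 0`; hence the Schur-complement certificate needs only `S(x*) ≻ 0` (append) -/

section VBlock

/-- **Quadratic form of `T(x)`** for a susceptance matrix with zero row sums (`B_ii = −Σ_{k≠i}B_ik`,
no shunt elements): `yᵀT(x)y = ½ Σ_iΣ_j B_ij (y_i² + y_j² − 2cos θ_ij y_iy_j)`.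
[cite: ShinZavala2020, Appendix B (proof of Proposition 2: «T(x) = T₁(x) + T₂(x) … −B_ii = Σ_{k∈N(i)} B_ik»)] -/
theorem hessT_quadForm_eq (hB : ∀ i j, M.B i j = M.B j i) (hrow : ∀ i, ∑ j, M.B i j = 0)
    (x : State n) (y : Fin n → ℝ) :
    y ⬝ᵥ (M.hessT x *ᵥ y)
      = 1 / 2 * ∑ i, ∑ j, M.B i j * (y i ^ 2 + y j ^ 2 - 2 * cos (x.1 i - x.1 j) * y i * y j) := by
  have h1 : y ⬝ᵥ (M.hessT x *ᵥ y) = ∑ i, ∑ j, -(M.B i j * cos (x.1 i - x.1 j) * y i * y j) := by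
    simp only [dotProduct, Matrix.mulVec, hessT, Matrix.of_apply, Finset.mul_sum]
    exact Finset.sum_congr rfl fun i _ => Finset.sum_congr rfl fun j _ => by ring
  have hA : ∑ i, ∑ j, M.B i j * y i ^ 2 = 0 := by
    refine Finset.sum_eq_zero fun i _ => ?_
    rw [← Finset.sum_mul, hrow i, zero_mul]
  have hA' : ∑ i, ∑ j, M.B i j * y j ^ 2 = 0 := by
    rw [Finset.sum_comm]
    refine Finset.sum_eq_zero fun j _ => ?_
    have : ∑ i, M.B i j * y j ^ 2 = (∑ i, M.B j i) * y j ^ 2 := by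
      rw [Finset.sum_mul]
      exact Finset.sum_congr rfl fun i _ => by rw [hB i j]
    rw [this, hrow j, zero_mul]
  have hsplit : ∀ i j, M.B i j * (y i ^ 2 + y j ^ 2 - 2 * cos (x.1 i - x.1 j) * y i * y j)
      = M.B i j * y i ^ 2 + M.B i j * y j ^ 2 - 2 * (M.B i j * cos (x.1 i - x.1 j) * y i * y j) :=
    fun i j => by ring
  rw [h1]
  simp only [hsplit, Finset.sum_sub_distrib, Finset.sum_add_distrib, ← Finset.mul_sum, hA, hA',
    Finset.sum_neg_distrib]
  ring

/-- **`T(x) ⪰ 0` at every state** (nonnegative line susceptances, zero row sums):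
`y_i² + y_j² − 2cos θ_ij y_iy_j ≥ 0` since `|cos| ≤ 1`.
[cite: ShinZavala2020, Appendix B (proof of Proposition 2: «T₁(x) is PSD … T₂(x) is PSD since it takes a weighted Laplacian form»)] -/
theorem hessT_quadForm_nonneg (hB : ∀ i j, M.B i j = M.B j i) (hBnn : ∀ i j, i ≠ j → 0 ≤ M.B i j)
    (hrow : ∀ i, ∑ j, M.B i j = 0) (x : State n) (y : Fin n → ℝ) :
    0 ≤ y ⬝ᵥ (M.hessT x *ᵥ y) := by
  rw [M.hessT_quadForm_eq hB hrow]
  refine mul_nonneg (by norm_num) (Finset.sum_nonneg fun i _ => Finset.sum_nonneg fun j _ => ?_)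
  by_cases h : i = j
  · subst h
    have : y i ^ 2 + y i ^ 2 - 2 * cos (x.1 i - x.1 i) * y i * y i = 0 := by
      rw [sub_self, Real.cos_zero]; ring
    rw [this, mul_zero]
  · refine mul_nonneg (hBnn i j h) ?_
    have hc1 : 0 ≤ 1 - cos (x.1 i - x.1 j) := sub_nonneg.2 (Real.cos_le_one _)
    have hc2 : 0 ≤ 1 + cos (x.1 i - x.1 j) := by linarith [Real.neg_one_le_cos (x.1 i - x.1 j)]
    nlinarith [mul_nonneg hc1 (sq_nonneg (y i + y j)), mul_nonneg hc2 (sq_nonneg (y i - y j))]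

/-- **`D(u) + T(x) ≻ 0` at every state with `V_i ≠ 0`** when `Q^u_i > 0` (the print's
`Q^d_i + V^d_i/k_Qi > 0`) and the susceptance matrix has nonnegative line entries and zero row sums —
the first half of the proof of Proposition 2 («Therefore, D(u) + T(x) is PD»).
[cite: ShinZavala2020, Appendix B, proof of Proposition 2] -/
theorem posDef_hessD_add_hessT (hB : ∀ i j, M.B i j = M.B j i)
    (hBnn : ∀ i j, i ≠ j → 0 ≤ M.B i j) (hrow : ∀ i, ∑ j, M.B i j = 0) (hQu : ∀ i, 0 < M.Qu i)
    (x : State n) (hV : ∀ i, x.2.2 i ≠ 0) : (M.hessD x + M.hessT x).PosDef := by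
  refine Matrix.PosDef.of_dotProduct_mulVec_pos ?_ fun y hy => ?_
  · rw [Matrix.IsHermitian, Matrix.conjTranspose_eq_transpose_of_trivial, Matrix.transpose_add,
      M.hessD_transpose, M.hessT_transpose hB]
  · rw [star_trivial, Matrix.add_mulVec, dotProduct_add]
    have hT := M.hessT_quadForm_nonneg hB hBnn hrow x y
    have hD : 0 < y ⬝ᵥ (M.hessD x *ᵥ y) := by
      obtain ⟨i, hi⟩ := Function.ne_iff.1 hy
      have hi' : y i ≠ 0 := hi
      have hcoef : ∀ j, 0 < M.Qu j / x.2.2 j ^ 2 := fun j =>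
        div_pos (hQu j) (pow_pos (abs_pos.2 (hV j)) 2 |>.trans_eq (by rw [pow_abs, abs_of_nonneg (sq_nonneg _)]))
      have hterm : ∀ j, 0 ≤ y j * (M.Qu j / x.2.2 j ^ 2 * y j) := fun j => by
        nlinarith [hcoef j, sq_nonneg (y j)]
      simp only [hessD, Matrix.mulVec_diagonal, dotProduct]
      refine lt_of_lt_of_le ?_ (Finset.single_le_sum (fun j _ => hterm j) (Finset.mem_univ i))
      have hyi : 0 < y i ^ 2 := lt_of_le_of_ne (sq_nonneg _) (Ne.symm (pow_ne_zero 2 hi'))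
      nlinarith [hcoef i]
    linarith

/-- **Stability from the Schur-complement certificate alone, `D + T ≻ 0` being automatic**: for a
network without shunt susceptance (`B_ij ≥ 0`, zero row sums), `Q^u_i > 0`, positive gains and time
constants, an equilibrium with `V* > 0` and Shin–Zavala's Schur complement `S(x*)` (16) positive
definite in a reference gauge is locally exponentially stable modulo the rotation.
[cite: ShinZavala2020, §IV-A eq. (16) and Proposition 2 (proof, Appendix B); SchifferEtAl2014, Proposition 5.9] -/
theorem expStable_modRotation_of_schur_posDef_noShunt (hB : ∀ i j, M.B i j = M.B j i)
    (hBnn : ∀ i j, i ≠ j → 0 ≤ M.B i j) (hrow : ∀ i, ∑ j, M.B i j = 0) (hQu : ∀ i, 0 < M.Qu i)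
    (hkP : ∀ i, 0 < M.kP i) (hτP : ∀ i, 0 < M.τP i) (hkQ : ∀ i, 0 < M.kQ i) (hτQ : ∀ i, 0 < M.τQ i)
    {xs : State n} (heq : M.field xs = 0) (hV : ∀ i, 0 < xs.2.2 i) (i₀ : Fin n)
    (hS : ∀ y : Fin n → ℝ, y i₀ = 0 → y ≠ 0 → 0 < y ⬝ᵥ (M.schurS xs *ᵥ y)) :
    ∃ ρ > 0, ∃ k > 0, ∃ lam > 0, ∀ (X : ℝ → State n) (T : ℝ), M.IsSolutionOn X (Icc 0 T) →
      ‖X 0 - xs‖ < ρ → ∃ c : ℝ, ∀ t ∈ Icc 0 T,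
        ‖X t - (xs + ((fun _ => c, 0, 0) : State n))‖ ≤ k * ‖X 0 - xs‖ * Real.exp (-lam * t) :=
  M.expStable_modRotation_of_schur_posDef hB hkP hτP hkQ hτQ heq hV i₀
    (M.posDef_hessD_add_hessT hB hBnn hrow hQu xs fun i => (hV i).ne') hS

/-- **Lemma 5.8 in the printed (reduced) form**: for a connected network with nonnegative line
susceptances, voltages `V > 0` and a phase-cohesive angle profile (`|θ_i − θ_j| ≤ π/2`, strictly
`< π/2` across the lines), the angle block `L(x)` with the row and column of a reference node `i₀`
deleted — the print's `(n − 1) × (n − 1)` matrix `L` — is POSITIVE DEFINITE («under the standing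
assumptions, L is positive definite»).  From the full-angle kernel statement
`hessL_quadForm_eq_zero_iff` and the tree's reference-minor lemma.
[cite: SchifferEtAl2014, §5.3 Lemma 5.8; ShinZavala2020, §IV-B («L̃(x̃) is PD if θ ∈ Θ_G(π/2) because L̃(x̃) is a reduced Laplacian»)] -/
theorem refMinor_hessL_posDef (hB : ∀ i j, M.B i j = M.B j i)
    (hBnn : ∀ i j, i ≠ j → 0 ≤ M.B i j) (hconn : ClassicalModel.CouplingConnected M.B)
    (x : State n) (hV : ∀ i, 0 < x.2.2 i) (hθ : ∀ i j, |x.1 i - x.1 j| ≤ π / 2)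
    (hcoh : ∀ i j, i ≠ j → 0 < M.B i j → |x.1 i - x.1 j| < π / 2) (i₀ : Fin n) :
    (Literature.LinearAlgebra.Matrix.refMinor (M.hessL x) i₀).PosDef := by
  have hform : ∀ v : Fin n → ℝ, (∃ i j, v i ≠ v j) → 0 < v ⬝ᵥ (M.hessL x *ᵥ v) := by
    rintro v ⟨i, j, hij⟩
    have h0 := M.hessL_quadForm_nonneg hB hBnn x (fun i => (hV i).le) hθ v
    rcases h0.lt_or_eq with h | h
    · exact h
    · exfalso
      obtain ⟨c, hc⟩ := (M.hessL_quadForm_eq_zero_iff hB hBnn hconn x hV hθ hcoh v).1 h.symm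
      exact hij (by rw [hc])
  have hH : (M.hessL x).IsHermitian := by
    rw [Matrix.IsHermitian, Matrix.conjTranspose_eq_transpose_of_trivial, M.hessL_transpose hB]
  refine Matrix.PosDef.of_dotProduct_mulVec_pos
    (Literature.LinearAlgebra.Matrix.refMinor_isHermitian hH i₀) fun u hu => ?_
  rw [star_trivial]
  exact Literature.LinearAlgebra.Matrix.refMinor_pos_of_form_pos hform i₀ u hu

end VBlock

end DroopPH

end Literature.MathematicalPhysics.PowerSystems

end
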